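import Mathlib
import HarnessLib
import HarnessLib.Audit
import Summits.AtomisticToContinuum.Statement
import HarnessLib.Audit.Status.Attr

/-!
Route: StrongClosureWeakBV

DORMANT since 2026-08-26T14:57:46Z (reconciler: no traction for 6.7 d (last activity item-proof-filed at 2026-08-19T22:25:47Z); parked, not closed — `ledger route dormant route-AtomisticToContinuum-StrongClosureWeakBV --off` to reactiva) — unstaffed, not closed; items shared with open routes are served there. `ledger route dormant <id> --off` reactivates.

# Route StrongClosureWeakBV — strong entropic closure of the deterministic gas — Dafermos decides
the conjunct before T*, Chen–Vasseur weak-BV crosses the shock in the planar class up to the first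
contact

It suffices to show X = GeneralStrongClosureT ∧ PlanarStrongClosure ∧ PlanarTraceRegularity ∧
WeakBVUniquenessHS (plus the known closer WeakStrongUniquenessHS3D): STRONG ENTROPIC CLOSURE of the
deterministic hard-sphere gas at fixed reduced density — along subsequences the empirical fields
converge in probability, at every time, to SOME bounded weak solution of the hard-sphere Euler
system obeying the single physical entropy inequality, with the right initial datum. Before T* and
for all profiles (GeneralStrongClosureT — positive horizons T > 0; the 2026-08-17 repair of
GeneralStrongClosure, stmt-9395, which was refuted-MISSTATED at the empty horizon T ≤ 0) Dafermos'
weak–strong uniqueness identifies the limit with the classical solution: the deciding theorem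
`closes (h₁ : GeneralStrongClosureT) (h₂ : WeakStrongUniquenessHS3D) : _root_.HydrodynamicLimit`
PROVES this soft assembly itself (subsequence principle + a.e. identification; rev 19/22, 2026-08-17
— see the Assembly section), and since the Statement re-type p126922 (2026-08-16) the conjunct is
itself packing-guarded (verbatim the former target HydroLimitInBand), so no dilute-self-consistency
bridge is needed. In the PLANAR class the same closure crosses T* (PlanarStrongClosure, contact-free
windows) and Chen–Vasseur weak–BV uniqueness replaces weak–strong uniqueness (WeakBVUniquenessHS,
with PlanarTraceRegularity supplying the competitor-class regularity): PlanarAssembly gives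
PlanarShockLimit — convergence to the small-BV entropy solution through shock formation, propagation
and shock–rarefaction interaction, up to the first shock–shock collision. Card realised:
planar-post-shock-weak-bv-uniqueness (spine; the D-0027-conforming successor of the retired route
PlanarWeakBV, whose assembly ended in the planar theorem).
Lean: `GeneralStrongClosureT ∧ PlanarStrongClosure ∧ PlanarTraceRegularity ∧ WeakBVUniquenessHS`

## Assembly
The deciding theorem IS the assembly, proved (rev 19, 2026-08-17; re-certified at the 2026-08-17
repair, rev 22, over the repaired crux; sorry-free: conclusion `_root_.HydrodynamicLimit` by name,
hypotheses = the two cruxes GeneralStrongClosureT (#2) and WeakStrongUniquenessHS3D (#6) only,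
axioms propext/Classical.choice/Quot.sound): `theorem closes (h₁ : GeneralStrongClosureT) (h₂ :
WeakStrongUniquenessHS3D) : _root_.HydrodynamicLimit`. Proof (≈170 lines of soft analysis, in the
route file): η₀ := min(η₁, η₂/2) (η₁ the closure's threshold, η₂ that of uniqueness), so that the
closure runs at η = η₀ and its limits (packing ≤ 2η₀ ≤ η₂) sit in the uniqueness regime; σ₀ from the
closure; given a classical solution on [0,T) obeying the Statement's guard ρσ³ < η₀, a flow family
with the t = 0 LLN and t₀ ∈ [0,T) — whence 0 < T, the positive-horizon hypothesis of the repaired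
crux — pick T′ ∈ (t₀,T); the classical solution restricts to [0,T′) (the one-sided time derivatives
within Ico 0 T′ and Ico 0 T agree below T′, `derivWithin_congr_set`) and is boxed on [0,T′] × 𝕋³ (0
< m ≤ ρ,θ ≤ M, |u| ≤ M) by compactness of [0,T′] × [0,1]³ through the fundamental-domain section
`repr`/`proj_repr`; for each χ, δ the full-sequence convergence of the JOINT deviation probability
follows from `Filter.tendsto_of_subseq_tendsto`: along any ns → ∞ extract a strictly monotone κ
(`strictMono_subseq_of_tendsto_atTop`), apply GeneralStrongClosureT to get κ′ and an entropic limit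
(ρ′,u′,θ′) on [0,T′) with its own box, pass to a common box (min/max), apply
WeakStrongUniquenessHS3D on [0,T′) to identify (ρ′,u′,θ′) with (ρ,u,θ) a.e. at t₀, rewrite the three
target integrals (`integral_congr_ae`) and read off convergence along ns∘φ∘κ′; the three components
of TendstoHydroFieldsAt are then squeezed under the joint bound (`Prod.dist_eq`, `measure_mono`).
REPAIR 2026-08-17 (rev 22): the original crux GeneralStrongClosure (stmt-9395) quantified `∀ T : ℝ`
with every time clause over `Set.Ico 0 T`, EMPTY for T ≤ 0 — there the "classical solution" and the
packing guard are vacuous and the datum (ρ 0, u 0, θ 0) arbitrary (witness: u 0 = 𝟙_V • e₀ on a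
Vitali set V ⊆ 𝕋³, the t = 0 LLN holding through the Bochner junk value / inner measure zero), while
conclusion (ii) still demanded a jointly measurable limit whose t = 0 slice equals the datum a.e.
(`Theorems.StrongClosureWeakBVGeneralStrongClosure_refuted`, refuted-misstated); it was replaced 1:1
by GeneralStrongClosureT = the refuter's repaired statement C′ (`0 < T →` inserted after
`IsHardSphereEulerSolution σ T ρ u θ →`: for T > 0 the solution predicate makes the t = 0 slices
smooth; the same corner and the same repair as LocalGibbsFineScale stmt-9905 → 17712 of route
BoxDissipativeWeakStrong), the refuted statement staying in the negatives index as this line's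
settled negative edge; `closes` needed one more line (`0 < T` from `t₀ ∈ Ico 0 T`). The assembly
record Assembly2 (kind assembly, rank 10) is the curried arrow GeneralStrongClosureT →
WeakStrongUniquenessHS3D → HydrodynamicLimit, a corollary of `closes` (`fun h₁ h₂ => closes h₁ h₂`),
not a hypothesis of it. History: rev ≤ 10 reached the old UNGUARDED abbrev through the shared bridge
DiluteSelfConsistency → HydroLimitInBand → HydrodynamicLimit (13-hypothesis closes); the re-type
p126922 made the conjunct verbatim HydroLimitInBand, so at the 2026-08-16 repair
DiluteSelfConsistency, HydroLimitInBand and the support glue GuardedAssembly were dropped here; at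
rev 19 the assembly's content was proved inside `closes`; rev 22 is the misstatement repair above.
The planar theorem PlanarShockLimit hangs off PlanarAssembly and is not part of the chain to the
conjunct: the cone audit of `closes` lists the planar items (PlanarStrongClosure,
PlanarTraceRegularity, WeakBVUniquenessHS, PlanarAssembly, PlanarShockLimit, PlanarLawInvariance,
HsEulerGNL, HsEntropyConvex) and Assembly2 as unused — by design of the card; whether the planar
items stay in this route or return to the card is a tenure decision (retriage note 2026-08-15).

Rationale: WHY THIS LINE. One microscopic claim, two PDE closers. The claim — limits of the particle fields are
deterministic, strong (no Young measure, no oscillation) and entropic — is what every compactness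
route needs; stated STRONGLY it is typable today over the conjunct's own vocabulary (laws, flows,
χ-tested fields; weak solutions inline through the torus calculus) whereas route
DissipativeWeakStrong's measure-valued version is still informal, and it is closed before T* by the
classical relative-entropy weak–strong uniqueness of Dafermos1979/Dafermos2005 (no Březina–Feireisl
machinery) and — the point of the card — AFTER T* in the planar class by weak–BV uniqueness: a
small-BV entropy solution is unique and L²-stable among bounded weak solutions with ONE entropy
inequality and strong traces (ChenKrupaVasseur2022 Thm 1.3 for 2×2, ChenVasseur2024 for
nonisentropic Euler; KangVasseur2020, KangVasseurWang2021, ChenKangVasseur2024, Vasseur2026 for the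
inviscid-limit versions), exactly the regularity a particle limit can hope for, while the symmetry
of the law removes every multi-dimensional wild solution (ChiodaroliDeLellisKreml2015,
Markfelder2021 Thm 8.3.1) for deterministic limits at zero cost. Imported area: hyperbolic
conservation laws (a-contraction with shifts, front tracking, Glimm's small-BV theory on the torus
QuXin2014, Vasseur's strong traces, Dafermos' relative entropy). New relative to the card and its
two audits, and the reason the planar theorem is cut back: a contact discontinuity born at a
shock–shock collision has width (Kn·t)^1/2 = N^-1/6 t^1/2 in the gas and is Rayleigh–Taylor unstable
whenever a passing wave accelerates it against its density jump, at rate (gA/w)^1/2 ≍ ε²N^1/12 → ∞,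
so thermal seeds N^-1/4 saturate in vanishing time and a mixing zone of N-independent width ≍ αAgt²
= O(ε⁴) should form — the baroclinic twin of the Kelvin–Helmholtz arithmetic of card
zero-horizon-statistical-solutions (BandakEtAl2024, KadauEtAl2004 for thermal seeding) — hence past
the first collision the transversally averaged limit should miss the exact entropy solution by O(ε⁷)
in L¹ (invisible below N ~ 10³⁰, fatal for an exact theorem), while shocks (Majda-stable,
doi:10.1090/memo/0275) and smooth entropy gradients are safe. No prior route reaches past T*.
Negatives index: one entry of this line — the original crux GeneralStrongClosure (stmt-9395),
refuted-MISSTATED 2026-08-17 at the EMPTY horizon T ≤ 0 (Vitali-set datum;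
`Theorems.StrongClosureWeakBVGeneralStrongClosure_refuted`) and replaced 1:1 by
GeneralStrongClosureT (positive horizons, the refuter's C′); the witness says nothing about the gas.
The pre-shock half is a deliberate strong variant of DissipativeWeakStrong which until the Statement
re-type p126922 shared ImplosionLoophole's packing bookkeeping (HydroLimitInBand,
DiluteSelfConsistency); since the re-type the conjunct IS the packing-guarded HydroLimitInBand
verbatim, so at the 2026-08-16 repair both were dropped here; since rev 19 (2026-08-17) the deciding
theorem `closes : GeneralStrongClosureT → WeakStrongUniquenessHS3D → _root_.HydrodynamicLimit` (rev
22: over the repaired crux) proves the soft assembly itself and concludes the Statement decl by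
name.

RANKED CRUXES. #2 GeneralStrongClosureT (crux; the 2026-08-17 repair of GeneralStrongClosure =
stmt-9395, refuted-misstated at T ≤ 0: `0 < T →` inserted after the solution predicate, nothing else
changed) — STRONG ENTROPIC CLOSURE BEFORE T* (all profiles; the half that decides the conjunct). ∃
η₀ > 0 ∀ η ∈ (0,η₀] ∀ continuous positive profiles (a₀, θ₀, u₀) on 𝕋³ ∃ σ₀ > 0 ∀ σ ∈ (0,σ₀) ∀ T ∀
classical hard-sphere-Euler solutions (ρ,u,θ) on [0,T) (IsHardSphereEulerSolution) WITH 0 < T whose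
packing stays ≤ η, ∀ flow families with the t = 0 law of large numbers: along EVERY subsequence κ
there is a further subsequence κ∘κ′ and a triple (ρ′,u′,θ′) on [0,T) × 𝕋³ such that (i) on every
[0,T′), T′ < T, it is a bounded measurable weak solution of the 3-D hard-sphere Euler system (mass,
the three momentum components, energy, with p = ρθZ(ρσ³), E = ρ(|u|²/2 + 3θ/2)) satisfying the
single physical entropy inequality ∂ₜ(−ρs) + div(−ρsu) ≤ 0 in 𝒟′ with initial term, continuous in
time into L¹, valued in some box (m ≤ ρ′,θ′ ≤ M, |u′| ≤ M) with packing ≤ 2η; (ii) its t = 0 slice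
is the classical datum a.e. (for T > 0 the datum is smooth, so the T = 0 Vitali witness is gone);
(iii) at EVERY t < T the empirical density/momentum/energy fields tested against every continuous χ
converge in probability along κ∘κ′ to (∫χρ′, ∫χρ′u′, ∫χE′)(t). In words: limits are deterministic,
strong (no Young measure) and entropic — determinism + mesoscale regularity + local-equilibrium flux
closure + free second law, merged in one statement (the strong twin of route DissipativeWeakStrong's
informal FluxClosure/EntropyAdmissibility, typed over the conjunct's vocabulary). [difficulty:
open-problem] (why it might fail: unproved for ANY deterministic interacting Hamiltonian system —
OVY1993 needs noise for the ergodic step (BoltzmannHypothesisBarrier); as stated the limit also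
needs a priori box bounds (no vacuum, packing ≤ 2η, |u′| ≤ M), velocity-tail / energy-flux control
and the entropy inequality, none of which follows from an LLN.) [Spohn1991, OllaVaradhanYau1993,
Dafermos2005, BrezinaFeireisl2018, FritzToth2004, BodineauGallagherSaintRaymondInvent2016]
#3 PlanarStrongClosure (crux) — STRONG ENTROPIC CLOSURE THROUGH THE SHOCK IN THE PLANAR CLASS (card
planar-post-shock-weak-bv-uniqueness cruxes 1–2 + the audit's determinism flag, merged; contact-free
windows). ∃ η₀ > 0 ∀ η ≤ η₀ ∀ continuous planar profiles (A, Θ > 0, U·e₁ on 𝕋¹) ∃ σ₀ ∀ σ < σ₀ ∀ box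
(m,M) ∃ ε₀ > 0 ∀ T ∀ 1-D REFERENCE (ρ,u,θ) on [0,T) × 𝕋¹ that is (S) a bounded measurable weak
entropy solution of planar hs-Euler with its own initial slice, time-continuous into L¹, (B) in the
box with packing ≤ η, (Vr) of variation ≤ ε₀ per period at every t, (C) CONTACT-FREE (wherever u is
continuous so is ρ), ∀ flow families with the t = 0 LLN towards its planar lift: along every
subsequence κ there is κ∘κ′ and a 1-D triple (ρ′,u′,θ′), again a weak entropy solution (S) on [0,T)
× 𝕋¹, in the widened box (m/2, 2M, packing ≤ 2η), with the reference's initial slice a.e., such that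
at EVERY t < T the 3-D empirical fields tested against every continuous χ on 𝕋³ converge in
probability along κ∘κ′ to the planar lift of (ρ′, ρ′u′e₁, E′)(t). (At T ≤ 0 this item is trivially
TRUE, not refutable: hypothesis (S) already makes the reference measurable and (ρ′,u′,θ′) := (ρ,u,θ)
serves.) The symmetry remark (transverse invariance of the law pins deterministic limits to planar
fields, PlanarLawInvariance) and 'particle compensated compactness' live inside the proof; shocks
form, propagate and interact with rarefactions inside the window. [deps: PlanarLawInvariance]
[difficulty: open-problem] (why it might fail: After T* nothing books mesoscale order or local
equilibrium (pre-shock large deviations do); L∞/no-vacuum bounds through compressions unproved;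
randomness may grow from thermal seeds at N-divergent rates (KH at slip surfaces N^1/6; RT at
accelerated contacts eps^2 N^1/12, excluded by the window).) [Spohn1991, ChenKrupaVasseur2022,
FritzToth2004, Fritz2011, doi:10.1090/memo/0275, BandakEtAl2024, KadauEtAl2004]
#4 PlanarTraceRegularity (crux) — STRONG TRACES OF PLANAR LIMITS (audit flag (2): the regularity
half of the weak–BV competitor class). For continuous planar profiles, σ < σ₀, every box (η,m,M),
horizon T, flow family and reindexing k: a 1-D triple (ρ′,u′,θ′) that is the in-probability limit
along k of the χ-tested 3-D fields at every t < T (as in PlanarStrongClosure (iii)) and a weak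
entropy solution (S) valued in the box has strong traces in Vasseur's ess-lim L¹ form along every
Lipschitz curve, from both sides, on every [0,T′], T′ < T. A limit that is BV in x at a.e. t has
them; the content is that particle limits are at least that regular. [deps: PlanarStrongClosure]
[difficulty: open-problem] (why it might fail: Strong traces are theorems for scalar laws (Vasseur
2001, kinetic formulation) and automatic for BV functions; for L∞ entropy solutions of systems they
are open (CKV 2022: mostly open) and a particle limit need not be BV; even the ess-lim form may fail
where wave interactions accumulate.) [doi:10.1007/s002050100157, ChenKrupaVasseur2022,
LegerVasseur2011, doi:10.1142/s0219891619500061, Dafermos2005]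
#5 WeakBVUniquenessHS (crux) — WEAK–BV UNIQUENESS FOR THE HARD-SPHERE LAW ON THE 1-TORUS (card crux
3; PDE). ∃ η₀ > 0 ∀ σ > 0 ∀ box (m,M) ∃ ε₀ > 0: on any [0,T) × 𝕋¹ a weak entropy solution (S) valued
in the box with packing ≤ η₀ and variation ≤ ε₀ per period at every t is UNIQUE among weak entropy
solutions (S) in the same box having ess-lim strong traces and the same t = 0 slice a.e.
ChenVasseur2024 (nonisentropic ideal gas: small-BV solutions unique among a large family of weak
solutions; weighted relative entropy with shifts + modified front tracking, CKV2022 Thm 1.3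
architecture) adapted to p = ρθZ(ρσ³), e = 3θ/2 (strict hyperbolicity, genuinely nonlinear acoustic
fields, strictly convex −ρs at packing < η₀: HsEulerGNL, HsEntropyConvex), localised to the torus by
finite propagation speed. [deps: HsEulerGNL, HsEntropyConvex] [difficulty: L] (why it might fail:
ChenVasseur2024 is printed for the ideal gas on R with the CKV competitor class (L∞, one entropy,
sup-form traces); for p = rho theta Z(rho sigma^3) the shock a-contraction criteria must be
re-verified (GNL and entropy convexity hold at small packing); ess-lim traces and the torus are
adaptations.) [ChenVasseur2024, ChenKrupaVasseur2022, KangVasseur2020, Vasseur2026,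
doi:10.1142/s0219891619500061, LegerVasseur2011, BressanGuerra2024]
#6 WeakStrongUniquenessHS3D (crux since the 2026-08-16 crux-only ruling — an unproved hypothesis of
`closes`; a known theorem whose TYPED INSTANCE is the risk) — DAFERMOS–DIPERNA WEAK–STRONG
UNIQUENESS FOR hs-EULER ON 𝕋³. ∃ η₀ > 0 ∀ σ > 0 ∀ box (m,M) ∀ T: a classical solution
(IsHardSphereEulerSolution σ T) valued in the box with packing ≤ η₀ and a bounded weak entropy
solution (same inline 3-D notion as in GeneralStrongClosureT) in the same box with the same t = 0
slice a.e. agree a.e. at every t < T (vacuous, hence harmless, at T ≤ 0). Relative entropy ∫ η(U′|U)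
with η = −ρs strictly convex on the box (HsEntropyConvex), Gronwall with the Lipschitz constant of
the classical solution on [0,t] (Dafermos2005 Thm 5.2.1 / 5.3.1-type; the single entropy inequality
suffices). [deps: HsEntropyConvex] [difficulty: L] (why it might fail: Dafermos' theorem needs
values in a compact set where −ρs is UNIFORMLY convex and p ∈ C²; as typed — inline χ-weak form, one
entropy inequality, every σ > 0, box closed at packing = η₀ — η₀ must lie inside the virial
analyticity radius (HsEosLowDensity, HsEntropyConvex); a typing slip makes it unprovable.)
[Dafermos1979, Dafermos2005, DiPernaMajda1987, BrezinaFeireisl2018]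
#10 Assembly2 (assembly record) — the curried arrow GeneralStrongClosureT → WeakStrongUniquenessHS3D
→ HydrodynamicLimit; its content is the body of `closes` (Assembly section), so it is closed by `fun
h₁ h₂ => closes h₁ h₂` and is NOT a hypothesis of `closes`. [deps: GeneralStrongClosureT,
WeakStrongUniquenessHS3D] [difficulty: done] [Dafermos2005, Spohn1991]
#9 PlanarShockLimit (support) — THE PLANAR POST-SHOCK THEOREM (card thesis, cut back to contact-free
windows; beyond the conjunct, hence support — D-0027): for continuous planar profiles, σ < σ₀, every
box, contact-free small-BV references (S, B with packing ≤ η₀, Vr ≤ ε₀, C) and every flow family,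
LLN at t = 0 towards the planar lift ⇒ LLN towards the lift at EVERY t < T — through shock
formation, propagation, decay and shock–rarefaction interaction, up to the first shock–shock
collision. [deps: PlanarAssembly] [difficulty: open-problem] [Spohn1991, ChenVasseur2024,
KangVasseurWang2021, Markfelder2021]
#9 PlanarAssembly (support) — PlanarStrongClosure → PlanarTraceRegularity → WeakBVUniquenessHS →
PlanarShockLimit; soft (η₀ := min(planar closure, weak–BV/2), ε₀ := min over the two boxes; a
failure of the LLN at t₀ along κ yields κ∘κ′, an entropic planar limit in the widened box with the
reference's initial slice and strong traces, hence equal to the reference a.e. — contradiction).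
[difficulty: M] [ChenKrupaVasseur2022, Dafermos2005]
#9 PlanarLawInvariance (support) — SYMMETRY OF THE LAW (provable now):
translation- /reflection-invariant profiles give a time-t law invariant under the corresponding
action on all particles (isometry invariance of canonicalDensity/hardSphereDomain, a.e. uniqueness
of trajectories, Liouville). [difficulty: provable-now] [Spohn1991, Alexander1975]
#9 HsEulerGNL (support) — STRUCTURE OF PLANAR hs-EULER AT LOW PACKING: ∃ η₀ > 0, Z =
hsCompressibility is C² on [0,η₀] and Φ := Z + ηZ′ + (2/3)Z² > 0 (strict hyperbolicity), Ψ := (2 +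
(2/3)Z)Φ + ηΦ′ > 0 (genuine nonlinearity); at η = 0: 5/3 and 40/9. [difficulty: M] [Ruelle1969,
LebowitzPenrose1964, Dafermos2005]
#9 HsEntropyConvex (support; shared with stmt-0817 of DissipativeWeakStrong) — strict convexity of U
= (ρ,m,E) ↦ −ρ(3/2 log θ(U) − log ρ − f_ex(ρσ³)) on {ρ > 0, ρσ³ < η₀, |m|² < 2ρE}. [difficulty: M]
[Dafermos2005, BrezinaFeireisl2018, Ruelle1969]

TWO-LAYER PLAN. Foreseen glued splits (nothing filed now; k ≤ 3, depth 1): GeneralStrongClosureT ⇐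
GeneralDeterminism (χ-tests concentrate around equicontinuous deterministic centres for t < T) →
GeneralMesoscaleRegularity (block fields self-average; expected block profiles L¹-equicontinuous) →
GeneralFluxClosure (strong limits are entropic weak solutions with the classical datum) →
GeneralStrongClosureT, every child typed at positive horizons `0 < T` from the start;
PlanarStrongClosure ⇐ the same three in the planar class for all t of a contact-free window (typed
versions exist in the retired file Theses/PlanarWeakBV.lean: PlanarDeterminism,
PlanarMesoscaleRegularity, PlanarEntropicClosure); WeakBVUniquenessHS ⇐ HsShockContraction
(Kang–Vasseur criteria for hs 1- /3-shocks) → TorusFrontTracking (CKV weighted front tracking with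
ess-lim traces) → WeakBVUniquenessHS; PlanarTraceRegularity ⇐ LimitIsBVae → TracesOfBV →
PlanarTraceRegularity. Support foreseen: SmallBVExistenceT1 (Glimm + finite propagation on 𝕋¹,
QuXin2014; typed in the retired file).

KILL CRITERIA. (i) ¬GeneralStrongClosureT at a POSITIVE horizon — in the smooth regime for one
profile (a persistent flux defect or macroscopic variance before T*) — closes the route
`refuted:GeneralStrongClosureT` and refutes in substance every compactness route (the T ≤ 0
refutation of the original GeneralStrongClosure was a typing corner, repaired 2026-08-17, and is no
such kill); (ii) ¬PlanarStrongClosure inside a contact-free window (e.g. an L¹ plateau or growing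
ensemble variance at a single decaying shock) closes the planar half — drop
PlanarStrongClosure/PlanarTraceRegularity/WeakBVUniquenessHS/PlanarShockLimit/PlanarAssembly, the
conjunct half survives; (iii) if WeakBVUniquenessHS fails for the hs law (an a-contraction shock
criterion violated at small packing) pivot the planar closer to BV-uniqueness without tame
oscillation (BressanGuerra2024 / Bressan–De Lellis 2023) at the price of a new crux 'the planar
limit has small BV', or to a-contraction performed at the particle level (weighted relative entropy
with shifts — a different mechanism, new card); (iv) [retired by the Statement re-type p126922]
DenseExcursion (ImplosionLoophole crux #2) no longer bears on this route or on the conjunct — the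
Statement is now packing-guarded (= the former HydroLimitInBand) and the bridge items
DiluteSelfConsistency/HydroLimitInBand were dropped here; (v) the card's UNRESTRICTED planar thesis
(through shock–shock collisions) is conjectured false here by the Rayleigh–Taylor arithmetic of Why
this line — a refuter who makes that rigorous in any caricature kills every exact post-collision
planar thesis; a proof that hs contacts stay RT-stable in the limit lets tenure restate
PlanarShockLimit without the contact-free clause.

NOT DECOMPOSED YET. The three mechanisms merged inside each closure crux (determinism / mesoscale
regularity / flux closure — typed separately in the retired file, to be re-filed as children by a
glued split); the restriction lemma and χ-test bookkeeping of the two soft assemblies;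
collision-flux tightness and velocity tails inside the closures; Majda/Lopatinski and
D'yakov–Kontorovich computations for hs shocks; SmallBVExistenceT1; definition items replacing the
`let` preludes; the post-collision regime (an 'Euler + RT mixing zone' limit — outside this route);
the ε-window corner (card burgers-window-through-the-shock) where the planar cruxes should be proved
first.

CHEAPEST FALSIFIER. Typing first (minutes; the 2026-08-17 refutation was of this kind): run the
degenerate-instance list over every item — empty horizon T ≤ 0 (now excluded in #2, vacuous or
trivially true in #3–#6), empty box M < m, non-measurable data (excluded: the solution predicates
carry measurability), Bochner junk values (targets are integrals of bounded measurable fields on the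
support of the test function). Symbolic next (an afternoon): with Z(η) = 1 + (2π/3)η + B₃η² + …
check on [0, η₀] the structural inputs of both closers — Φ = Z + ηZ′ + 2Z²/3 > 0, Ψ = (2 + 2Z/3)Φ +
ηΦ′ > 0 (at η = 0: 5/3 and 40/9), strict convexity of −ρs (HsEntropyConvex) — and the Kang–Vasseur
a-contraction criterion for weak 1- /3-shocks of this law; a failure at small packing kills
WeakBVUniquenessHS as stated. Then MD (decisive for both closures, cheap): event-driven hard spheres
at φ = 0.05 in a thin periodic cross-section, N = 10⁵–10⁷, planar 3-simple-wave data u¹ = δ sin 2πx₁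
of finite amplitude: ensemble variance of χ-tested fields and L¹ distance of slab profiles to a 1-D
Godunov/Glimm solution, before T* (GeneralStrongClosureT in its planar instance) and through
formation and decay of the single shock per period (PlanarStrongClosure), must decay like powers of
N with NO plateau after T*; a plateau or growing variance kills the line. (The post-collision RT
deviation predicted above is O(ε⁷) and needs N ≳ 10³⁰: only theory separates the restricted from the
unrestricted planar thesis.)

NUMBERS. Kn = mean free path ≍ N^-1/3/σ² (macroscopic units), shock width O(Kn), ≍ N^1/3 collisions
per particle per unit time; contact width (Kn t)^1/2 = N^-1/6 t^1/2, thermal seed at that scale (N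
w³)^-1/2 = N^-1/4; KH growth at a slip surface ΔU N^1/6 t^1/2 (zero-horizon card) vs RT growth at an
accelerated contact (gA)^1/2 Kn^-1/4 t^3/4 ≍ ε²N^1/12 (A ≍ ε³, g ≍ ε), mixing width αAgt² ≈ 0.05 ε⁴,
L¹ defect ≈ 0.05 ε⁷; c² → 5θ/3, Ψ(0) = 40/9; items at open: 14 (4 cruxes, 9 support, 1 assembly);
after the 2026-08-16/17 repairs: 11 active (5 cruxes — GeneralStrongClosureT, PlanarStrongClosure,
PlanarTraceRegularity, WeakBVUniquenessHS, WeakStrongUniquenessHS3D — 5 support, and the assembly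
record Assembly2), plus retired records (the refuted GeneralStrongClosure stmt-9395 and the earlier
drops); `closes` has 2 hypotheses (cruxes #2 and #6) and a ≈170-line sorry-free proof; longest
signature 3840 chars.

DEFINITION REQUESTS. To be filed by tenure (they would replace the `let` preludes every long item
carries; tenure restates when they land): `HsEulerWeakEntropySolution σ T ρ u θ` on 𝕋³ and its
planar twin on 𝕋¹ (topic Literature/Analysis/FluidPDE: bounded measurable fields, conservation laws
and the −ρs inequality in 𝒟′ with initial term, C([0,T); L¹)); `HasStrongTraces T ρ u θ` (Vasseur's
ess-lim L¹ traces along Lipschitz curves). Cite facts wanted: ChenVasseur2024 main theorem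
(acq-02251 pending, paywalled), QuXin2014 (acq-02344), Majda 1983 uniform stability of gas-dynamic
shocks.

Novelty: Searches (2026-08-15): `lit search --source crossref "weak-BV uniqueness nonisentropic Euler Chen
Vasseur"` (10 rows: doi:10.4208/cmaa.2024-0019, doi:10.5802/jedp.701,
doi:10.1007/s00205-022-01813-0); `lit read doi:10.5802/jedp.701` (Vasseur2026 survey pp. 2–8, 12–14:
Thm 1–2, inviscid-limit weak/BV stability needs neither traces nor L∞ bounds; refs
[15],[16],[31],[32]); `lit read arxiv:2010.04761` (CKV: S_weak, Def 1.2, Thm 1.3/1.4); `lit read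
doi:10.4208/cmaa.2024-0019` → paywalled, abstract only (acq-02251); `lit search --source crossref
"Qu Xin long time existence ... periodic"` (doi:10.1007/s00205-014-0807-0, paywalled, acq-02344);
three crossref searches on thermal-noise-seeded Rayleigh–Taylor / spontaneous stochasticity
(doi:10.1073/pnas.0401228101, doi:10.1103/physrevlett.132.104002, doi:10.1103/physreve.105.065113);
`lit frontier AtomisticToContinuum --since 2020` (30 rows, none on a-contraction / weak-BV / planar
post-shock particle limits); `lit bridges AtomisticToContinuum --cross any` (none relevant); `lit
galaxy search "weak-BV uniqueness for nonisentropic Euler" --star all` (0 hits; `--star pdf`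
saturated rc 1); local hybrid daemon down at 11:15Z; the 135 cards of the sub grep'd for
Rayleigh/contact/Richtmyer (only zero-horizon-statistical-solutions treats thin-layer instability,
for shear); the 7 open route files of the sub read (none past T*; DissipativeWeakStrong's closure
cruxes informal); `ledger negatives` (0); the retired route PlanarWeakBV (this planner  [refs: 10.4208/cmaa.2024-0019, 10.5802/jedp.701, 10.1007/s00205-022-01813-0, 10.5802/jedp.701`, 10.4208/cmaa.2024-0019`, 10.1007/s00205-014-0807-0, 10.1073/pnas.0401228101, 10.1103/physrevlett.132.104002, 10.1103/physreve.105.065113, 2010.04761, doi:10.4208/cmaa.2024-0019, doi:10.5802/jedp.701, doi:10.1007/s00205-022-01813-0, arxiv:2010.04761, doi:10.1007/s00205-014-0807-0, doi:10.1073/pnas.0401228101, d]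

Barriers (technique_class: weak-BV-uniqueness a-contraction symmetry-reduction): - technique_class: weak-BV-uniqueness a-contraction symmetry-reduction
- Literature.Barriers.AtomisticToContinuum.ShockFormationBarrier: the conjunct half stays in the
smooth regime (evasion (i): weak–strong uniqueness); the planar half crosses it — no smooth
reference after T*, the reference is the small-BV entropy solution and the stability theory is
a-contraction with shifts, built for discontinuous references (the Narrow entry records that the
printed restriction is for the unshifted-reference family only); outside symmetry-reduced classes
the barrier stands.
- Literature.Barriers.AtomisticToContinuum.WildSolutionsBarrier: not met before T* (scope caveat
(c)); evaded after T* — wild admissible solutions on planar data are non-planar (Markfelder2021 Thm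
8.3.4: only the velocity is wild, via 2-D fans), hence not in-probability DETERMINISTIC limits of an
x₂,x₃-invariant law (PlanarStrongClosure (iii) + PlanarLawInvariance), and among planar bounded
entropy solutions with traces uniqueness holds (WeakBVUniquenessHS); the Narrow entry already notes
that a-contraction against one planar target never uses uniqueness in the L∞ admissible class.
Honest residue: if planar determinism fails, the symmetry remark is void.
- Literature.Barriers.AtomisticToContinuum.NoBVEstimatesMultiDBarrier: evaded — in 3-D only
L²/relative-entropy stability of the classical solution is used (evasion (i)); after the symmetry
reduction the post-shock problem is one-dimensional (evasion (ii)); no BV est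

History (route lifecycle, newest last):
- 2026-08-16T23:41:37Z · rev 14: dropped stmt-AtomisticToContinuum-9133 — route-repair step 3b (crux-only ruling 2026-08-16): GuardedAssembly (stmt-9400) restated to conclude the Statement decl by name — WeakStrongUniquenessHS3D → Gen (planner-rrepair-AtomisticToContinuum-StrongClo-bb7bb109-0)
- 2026-08-16T23:44:17Z · rev 15: dropped stmt-AtomisticToContinuum-17857 — route-repair step 3c-i (crux-only ruling; transient): drop GuardedAssembly (stmt-17857, support, rank 9) so it can be re-filed under the same name as a CRUX of (planner-rrepair-AtomisticToContinuum-StrongClo-bb7bb109-0)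
- 2026-08-16T23:57:19Z · LINT AUTOFIX route.multi-assembly: kept Assembly2, dropped Assembly, Assembly3 (gate:hygiene)
- 2026-08-17T00:13:16Z · rev 21: restated Assembly2 (stmt-AtomisticToContinuum-17907) — route-repair follow-up: restate the assembly record Assembly2 to the canonical curried arrow GeneralStrongClosure → WeakStrongUniquenessHS3D → _root_.Hydrodynam (planner-rbadge-AtomisticToContinuum-StrongClos-b8f25ab7-g2-0)
- 2026-08-17T00:36:11Z · BROKEN — GeneralStrongClosure (stmt-AtomisticToContinuum-9395, crux) refuted by Summit.AtomisticToContinuum.HydrodynamicLimit.Theorems.StrongClosureWeakBVGeneralStrongClosure_refuted @ 722e240af802 (refuter-rreview1-AtomisticToContinuum-StrongClo-b8f25ab7-0)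
- 2026-08-17T00:55:30Z · rev 22: restated GeneralStrongClosure (stmt-AtomisticToContinuum-9395 refuted), Assembly2 (stmt-AtomisticToContinuum-18084) — repair (route-repair rfix-AtomisticToContinuum-StrongClos-b8f25ab7, rev 22): GeneralStrongClosure (stmt-9395, crux r2) was refuted-MISSTATED by Theorems.StrongC (planner-rfix-AtomisticToContinuum-StrongClos-b8f25ab7-0)
- 2026-08-17T00:55:30Z · REPAIRED (restate GeneralStrongClosure, Assembly2) — back to open: repair (route-repair rfix-AtomisticToContinuum-StrongClos-b8f25ab7, rev 22): GeneralStrongClosure (stmt-9395, crux r2) was refuted-MISSTATED by Theorems.StrongC (planner-rfix-AtomisticToContinuum-StrongClos-b8f25ab7-0)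
- 2026-08-26T14:57:46Z · DORMANT — reconciler: no traction for 6.7 d (last activity item-proof-filed at 2026-08-19T22:25:47Z); parked, not closed — `ledger route dormant route-AtomisticToContinuu (operator:999:3644990)

sub-problem: HydrodynamicLimit · status: dormant · opened planner-plancard-AtomisticToContinuum-Hydrody-a9f5d164-0 2026-08-15T13:56:48Z · rev 22 · ledger route-AtomisticToContinuum-StrongClosureWeakBV
GENERATED by the gate from the ledger (D-0016/17). Provers cite these decls: `theorem foo : Summit.AtomisticToContinuum.HydrodynamicLimit.Theses.StrongClosureWeakBV.<Decl> := …` in Summits/AtomisticToContinuum/HydrodynamicLimit/Theorems/<Name>.lean.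
-/

namespace Summit.AtomisticToContinuum.HydrodynamicLimit.Theses.StrongClosureWeakBV

open scoped BigOperators Topology Manifold Classical MeasureTheory ProbabilityTheory Matrix InnerProductSpace ComplexConjugate ContinuousMap
open Filter Set Function TopologicalSpace MeasureTheory

attribute [summit_statement] _root_.HydrodynamicLimit

/-- item stmt-AtomisticToContinuum-16991 · crux · rank 2 · open · by planner
why it might fail: Unproved for ANY deterministic interacting Hamiltonian system (OVY1993 needs noise for the ergodic step: BoltzmannHypothesisBarrier); also needs a priori box bounds (no vacuum, packing ≤ 2η, |u′| ≤ M), velocity-tail/energy-flux control and the entropy inequality, none of which an LLN gives.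
sources: OllaVaradhanYau1993, Spohn1991, FritzToth2004, BodineauGallagherSaintRaymondInvent2016, Dafermos2005, Literature.Barriers.AtomisticToContinuum.BoltzmannHypothesisBarrier
[crux] STRONG ENTROPIC CLOSURE BEFORE T*, POSITIVE HORIZONS (all profiles; the half that decides the
conjunct) — the 2026-08-17 REPAIR of GeneralStrongClosure (stmt-AtomisticToContinuum-9395), which
was refuted-MISSTATED by Theorems.StrongClosureWeakBVGeneralStrongClosure_refuted at the EMPTY
horizon T = 0 (there `IsHardSphereEulerSolution σ 0` and the packing guard are vacuous, the datum (ρ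
0, u 0, θ 0) is arbitrary — witness u 0 = 𝟙_V • e₀ on a Vitali set V ⊆ 𝕋³, the t = 0 LLN holding
through the Bochner junk value / inner measure zero — while (ii) demands a jointly measurable limit
whose t = 0 slice is the datum a.e.): verbatim the old statement with `0 < T →` inserted after
`IsHardSphereEulerSolution σ T ρ u θ →` (the refuter's repaired statement C′, which the witness
misses: for T > 0 the solution predicate makes the t = 0 slices smooth; the same corner and repair
as LocalGibbsFineScale stmt-9905 → 17712). ∃ η₀ > 0 ∀ η ∈ (0,η₀] ∀ continuous positive profiles (a₀,
θ₀, u₀) on 𝕋³ ∃ σ₀ > 0 ∀ σ ∈ (0,σ₀) ∀ T ∀ classical hard-sphere-Euler solutions (ρ,u,θ) on [0,T)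
(IsHardSphereEulerSolution σ T) WITH 0 < T, whose packing stays ≤ η, ∀ flow families with the t = 0
law of large numbers -/
@[route_item "route-AtomisticToContinuum-StrongClosureWeakBV", crux]
def GeneralStrongClosureT : Prop :=
  ∃ η₀ > (0 : ℝ), ∀ η, 0 < η → η ≤ η₀ → ∀ a₀ θ₀ : UnitAddTorus (Fin 3) → ℝ, ∀ u₀ : UnitAddTorus (Fin 3) → EuclideanSpace ℝ (Fin 3), Continuous a₀ → Continuous θ₀ → Continuous u₀ → (∀ x, 0 < a₀ x ∧ 0 < θ₀ x) → ∃ σ₀ > (0 : ℝ), ∀ σ, 0 < σ → σ < σ₀ → let W3 := fun (a : ℝ → UnitAddTorus (Fin 3) → ℝ) (F : ℝ → UnitAddTorus (Fin 3) → EuclideanSpace ℝ (Fin 3)) (φ : ℝ → UnitAddTorus (Fin 3) → ℝ) => (∫ t in Set.Ioi 0, ∫ x, (a t x * Literature.Analysis.FunctionSpaces.Torus.timeDeriv φ t x + inner ℝ (F t x) (Literature.Analysis.FunctionSpaces.Torus.gradient (φ t) x))) + ∫ x, a 0 x * φ 0 x; let S3 := fun (T : ℝ) (ρ θ : ℝ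 → UnitAddTorus (Fin 3) → ℝ) (u : ℝ → UnitAddTorus (Fin 3) → EuclideanSpace ℝ (Fin 3)) => let E := fun (t : ℝ) (x : UnitAddTorus (Fin 3)) => Literature.MathematicalPhysics.KineticTheory.totalEnergyDensity (ρ t x) (u t x) (θ t x); let p := fun (t : ℝ) (x : UnitAddTorus (Fin 3)) => Literature.MathematicalPhysics.KineticTheory.hsPressure σ (ρ t x) (θ t x); let H := fun (t : ℝ) (x : UnitAddTorus (Fin 3)) => -(ρ t x * (3 / 2 * Real.log (θ t x) - Real.log (ρ t x) - Literature.MathematicalPhysics.KineticTheory.hsExcessFreeEnergy (ρ t x * σ ^ 3))); (∀ f ∈ [ρ, θ], Measurable (Function.uncurry f)) ∧ Measurable (Function.uncurry u) ∧ (∀ t ∈ Set.Ico 0 T, Filter.Tendsto (fun s : ℝ => ∫ x, dist (ρ s x, u s x, θ s x) (ρ t x, u t x, θ t x)) (nhdsWithin t (Set.Ico 0 T)) (nhds 0)) ∧ ∀ φ : ℝ → UnitAddTorus (Fin 3) → ℝ, ContDiff ℝ (⊤ : ℕ∞) (Literature.Analysis.FunctionSpaces.Torus.stLift φ) → (∃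 T' < T, ∀ t, T' ≤ t → ∀ x, φ t x = 0) → W3 ρ (fun t x => ρ t x • u t x) φ = 0 ∧ (∀ i : Fin 3, W3 (fun t x => ρ t x * u t x i) (fun t x => (ρ t x * u t x i) • u t x + p t x • EuclideanSpace.single i (1 : ℝ)) φ = 0) ∧ W3 E (fun t x => (E t x + p t x) • u t x) φ = 0 ∧ ((∀ t x, 0 ≤ φ t x) → 0 ≤ W3 H (fun t x => H t x • u t x) φ); let B3 := fun (η m M T : ℝ) (ρ θ : ℝ → UnitAddTorus (Fin 3) → ℝ) (u : ℝ → UnitAddTorus (Fin 3) → EuclideanSpace ℝ (Fin 3)) => ∀ t ∈ Set.Ico 0 T, ∀ x, m ≤ ρ t x ∧ ρ t x ≤ M ∧ m ≤ θ t x ∧ θ t x ≤ M ∧ ‖u t x‖ ≤ M ∧ ρ t x * σ ^ 3 ≤ η; let ST := fun (N : ℕ) (z : Literature.Analysis.FluidPDE.Config (N + 1) (Fin 3) (UnitAddTorus (Fin 3))) (χ : UnitAddTorus (Fin 3) → ℝ) => (Literature.MathematicalPhysics.KineticTheory.empiricalDensityField z χ, Literature.MathematicalPhysics.KineticTheory.empiricalMomentumField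 z χ, Literature.MathematicalPhysics.KineticTheory.empiricalEnergyField z χ); ∀ T : ℝ, ∀ ρ θ : ℝ → UnitAddTorus (Fin 3) → ℝ, ∀ u : ℝ → UnitAddTorus (Fin 3) → EuclideanSpace ℝ (Fin 3), Literature.MathematicalPhysics.KineticTheory.IsHardSphereEulerSolution σ T ρ u θ → 0 < T → (∀ t ∈ Set.Ico 0 T, ∀ x, ρ t x * σ ^ 3 ≤ η) → ∀ Φ : ((N : ℕ) → Literature.Analysis.FluidPDE.HardSphereFlow (Literature.Analysis.FluidPDE.Torus.geometry (Fin 3)) (Literature.MathematicalPhysics.KineticTheory.hsDiameter σ N) (N + 1)), let Lw := fun N : ℕ => Literature.MathematicalPhysics.KineticTheory.localGibbsLaw σ a₀ u₀ θ₀ N (Φ N); let LLk := fun (k : ℕ → ℕ) (ρ θ : ℝ → UnitAddTorus (Fin 3) → ℝ) (u : ℝ → UnitAddTorus (Fin 3) → EuclideanSpace ℝ (Fin 3)) (t : ℝ) => ∀ χ : UnitAddTorus (Fin 3) → ℝ, Continuous χ → ∀ δ > (0 : ℝ), Filter.Tendsto (fun n : ℕ => Lw (k n) {z | δ < dist (ST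 (k n) ((Φ (k n)).flow t z) χ) (∫ x, χ x * ρ t x, ∫ x, (χ x * ρ t x) • u t x, ∫ x, χ x * Literature.MathematicalPhysics.KineticTheory.totalEnergyDensity (ρ t x) (u t x) (θ t x))}) Filter.atTop (nhds 0); Literature.MathematicalPhysics.KineticTheory.TendstoHydroFieldsAt Lw Φ ρ u θ 0 → ∀ κ : ℕ → ℕ, StrictMono κ → ∃ κ' : ℕ → ℕ, StrictMono κ' ∧ ∃ ρ' θ' : ℝ → UnitAddTorus (Fin 3) → ℝ, ∃ u' : ℝ → UnitAddTorus (Fin 3) → EuclideanSpace ℝ (Fin 3), (∀ T' < T, S3 T' ρ' θ' u' ∧ ∃ m M : ℝ, 0 < m ∧ B3 (2 * η) m M T' ρ' θ' u') ∧ (∀ᵐ x : UnitAddTorus (Fin 3), ρ' 0 x = ρ 0 x ∧ u' 0 x = u 0 x ∧ θ' 0 x = θ 0 x) ∧ ∀ t ∈ Set.Ico 0 T, LLk (κ ∘ κ') ρ' θ' u' t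

/-- item stmt-AtomisticToContinuum-9396 · crux · rank 3 · open · by planner
why it might fail: Past T* nothing books local equilibrium or mesoscale order (pre-shock large deviations do); sup/no-vacuum bounds through compressions unproved even for the PDE; thermal seeds N^-1/4 may grow at N-divergent rates (KH ~N^1/6 at slip lines; RT ~eps^2 N^1/12 at accelerated contacts, cut by the window).
sources: Spohn1991, ChenKrupaVasseur2022, FritzToth2004, Fritz2011, BandakEtAl2024, KadauEtAl2004
[crux] STRONG ENTROPIC CLOSURE THROUGH THE SHOCK IN THE PLANAR CLASS (card
planar-post-shock-weak-bv-uniqueness cruxes 1–2 + the audit's determinism flag, merged; contact-free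
windows). ∃ η₀ > 0 ∀ η ≤ η₀ ∀ continuous planar profiles (A, Θ > 0, U·e₁ on 𝕋¹) ∃ σ₀ ∀ σ < σ₀ ∀ box
(m,M) ∃ ε₀ > 0 ∀ T ∀ 1-D REFERENCE (ρ,u,θ) on [0,T) × 𝕋¹ that is (S) a bounded measurable weak
entropy solution of planar hs-Euler with its own initial slice, time-continuous into L¹, (B) in the
box with packing ≤ η, (Vr) of variation ≤ ε₀ per period at every t, (C) CONTACT-FREE (wherever u is
continuous so is ρ), ∀ flow families with the t = 0 LLN towards its planar lift: along every
subsequence κ there is κ∘κ′ and a 1-D triple (ρ′,u′,θ′), again a weak entropy solution (S) on [0,T)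
× 𝕋¹, in the widened box (m/2, 2M, packing ≤ 2η), with the reference's initial slice a.e., such that
at EVERY t < T the 3-D empirical fields tested against every continuous χ on 𝕋³ converge in
probability along κ∘κ′ to the planar lift of (ρ′, ρ′u′e₁, E′)(t). The symmetry remark (S of the
card: transverse invariance of the law pins deterministic limits to planar fields,
PlanarLawInvariance) and 'particle compensated compactness' live -/
@[route_item "route-AtomisticToContinuum-StrongClosureWeakBV"]
def PlanarStrongClosure : Prop :=
  let T1 : Type := UnitAddTorus (Fin 1); let pt : ℝ → T1 := fun r _ => ((r : ℝ) : UnitAddCircle); let e₀ := EuclideanSpace.single (0 : Fin 3) (1 : ℝ); let P := Literature.MathematicalPhysics.KineticTheory.hsPressure; let fx := Literature.MathematicalPhysics.KineticTheory.hsExcessFreeEnergy; let W := fun (a f φ : ℝ → T1 → ℝ) => (∫ t in Set.Ioi 0, ∫ y, (a t y * Literature.Analysis.FunctionSpaces.Torus.timeDeriv φ t y + f t y * Literature.Analysis.FunctionSpaces.Torus.partialDeriv (0 : Fin 1) (φ t) y)) + ∫ y, a 0 y * φ 0 y; let En := fun (ρ u θ : ℝ → T1 → ℝ) (t : ℝ)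 (y : T1) => ρ t y * (u t y ^ 2 / 2 + 3 / 2 * θ t y); let V := fun (ρ u θ : ℝ → T1 → ℝ) (t r : ℝ) => (ρ t (pt r), u t (pt r), θ t (pt r)); let J := fun (g : ℝ → ℝ) (r : ℝ) => Function.leftLim g r = Function.rightLim g r; let Fl := fun (σ : ℝ) => (N : ℕ) → Literature.Analysis.FluidPDE.HardSphereFlow (Literature.Analysis.FluidPDE.Torus.geometry (Fin 3)) (Literature.MathematicalPhysics.KineticTheory.hsDiameter σ N) (N + 1); let ST := fun (N : ℕ) (z : Literature.Analysis.FluidPDE.Config (N + 1) (Fin 3) (UnitAddTorus (Fin 3))) (χ : UnitAddTorus (Fin 3) → ℝ) => (Literature.MathematicalPhysics.KineticTheory.empiricalDensityField z χ, Literature.MathematicalPhysics.KineticTheory.empiricalMomentumField z χ, Literature.MathematicalPhysics.KineticTheory.empiricalEnergyField z χ); ∃ η₀ > (0 : ℝ), ∀ η, 0 < η → η ≤ η₀ → ∀ A Θ U : T1 → ℝ, Continuous A → Continuous Θ → Continuous U → (∀ y, 0 < A y ∧ 0 < Θ y) → ∃ σ₀ > (0 : ℝ), ∀ σ, 0 <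 σ → σ < σ₀ → ∀ m M : ℝ, 0 < m → ∃ ε₀ > (0 : ℝ), ∀ T : ℝ, let S := fun ρ u θ : ℝ → T1 → ℝ => let q := fun (t : ℝ) (y : T1) => ρ t y * u t y; let H := fun (t : ℝ) (y : T1) => -(ρ t y * (3 / 2 * Real.log (θ t y) - Real.log (ρ t y) - fx (ρ t y * σ ^ 3))); (∀ f ∈ [ρ, u, θ], Measurable (Function.uncurry f)) ∧ (∀ t ∈ Set.Ico 0 T, Filter.Tendsto (fun s : ℝ => ∫ y, dist (ρ s y, u s y, θ s y) (ρ t y, u t y, θ t y)) (nhdsWithin t (Set.Ico 0 T)) (nhds 0)) ∧ ∀ φ : ℝ → T1 → ℝ, ContDiff ℝ (⊤ : ℕ∞) (Literature.Analysis.FunctionSpaces.Torus.stLift φ) → (∃ T' < T, ∀ t, T' ≤ t → ∀ y, φ t y = 0) → W ρ q φ = 0 ∧ W q (fun t y => q t y * u t y + P σ (ρ t y) (θ t y)) φ = 0 ∧ W (En ρ u θ) (fun t y => (En ρ u θ t y + P σ (ρ t y) (θ t y)) * u t y) φ = 0 ∧ ((∀ t y, 0 ≤ φ t y) → 0 ≤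 W H (fun t y => H t y * u t y) φ); let B := fun (η m M : ℝ) (ρ u θ : ℝ → T1 → ℝ) => ∀ t ∈ Set.Ico 0 T, ∀ y, m ≤ ρ t y ∧ ρ t y ≤ M ∧ m ≤ θ t y ∧ θ t y ≤ M ∧ |u t y| ≤ M ∧ ρ t y * σ ^ 3 ≤ η; let Vr := fun (ε : ℝ) (ρ u θ : ℝ → T1 → ℝ) => ∀ t ∈ Set.Ico 0 T, eVariationOn (V ρ u θ t) (Set.Icc 0 1) ≤ ENNReal.ofReal ε; let C := fun ρ u : ℝ → T1 → ℝ => ∀ t ∈ Set.Ico 0 T, ∀ r : ℝ, J (fun r' => u t (pt r')) r → J (fun r' => ρ t (pt r')) r; ∀ ρ u θ : ℝ → T1 → ℝ, S ρ u θ → B η m M ρ u θ → Vr ε₀ ρ u θ → C ρ u → ∀ Φ : Fl σ, let Lw := fun N : ℕ => Literature.MathematicalPhysics.KineticTheory.localGibbsLaw σ (fun x => A (fun _ => x 0)) (fun x => U (fun _ => x 0) • e₀) (fun x => Θ (fun _ => x 0)) N (Φ N); let LLP := fun (k : ℕ → ℕ) (ρ u θ : ℝ → T1 → ℝ) (t :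 ℝ) => ∀ χ : UnitAddTorus (Fin 3) → ℝ, Continuous χ → ∀ δ > (0 : ℝ), Filter.Tendsto (fun n : ℕ => Lw (k n) {z | δ < dist (ST (k n) ((Φ (k n)).flow t z) χ) (∫ x, χ x * ρ t (fun _ => x 0), ∫ x, (χ x * ρ t (fun _ => x 0) * u t (fun _ => x 0)) • e₀, ∫ x, χ x * En ρ u θ t (fun _ => x 0))}) Filter.atTop (nhds 0); Literature.MathematicalPhysics.KineticTheory.TendstoHydroFieldsAt Lw Φ (fun s x => ρ s (fun _ => x 0)) (fun s x => u s (fun _ => x 0) • e₀) (fun s x => θ s (fun _ => x 0)) 0 → ∀ κ : ℕ → ℕ, StrictMono κ → ∃ κ' : ℕ → ℕ, StrictMono κ' ∧ ∃ ρ' u' θ' : ℝ → T1 → ℝ, S ρ' u' θ' ∧ B (2 * η) (m / 2) (2 * M) ρ' u' θ' ∧ (∀ᵐ y : T1, ρ' 0 y = ρ 0 y ∧ u' 0 y = u 0 y ∧ θ' 0 y = θ 0 y) ∧ ∀ t ∈ Set.Ico 0 T, LLP (κ ∘ κ') ρ' u' θ' t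

/-- item stmt-AtomisticToContinuum-9397 · crux · rank 4 · open · by planner
why it might fail: Strong traces are known only for scalar laws (Vasseur2001) and a.e.-BV slices (hasStrongTraces_of_ae_boundedVariationOn); for bounded solutions of systems 'mostly open' (CKV2022 p.5); nothing makes a particle limit BV: accumulating interactions or residual oscillation may defeat the ess-lim L1 form.
sources: Vasseur2001, doi:10.1142/s0219891605000658, ChenKrupaVasseur2022, KrupaVasseur2019, LegerVasseur2011, Literature.Analysis.PDE.hasStrongTraces_of_ae_boundedVariationOn
[crux] STRONG TRACES OF PLANAR LIMITS (audit flag (2): the regularity half of the weak–BV competitor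
class). For continuous planar profiles, σ < σ₀, every box (η,m,M), horizon T, flow family and
reindexing k: a 1-D triple (ρ′,u′,θ′) that is the in-probability limit along k of the χ-tested 3-D
fields at every t < T (as in PlanarStrongClosure (iii)) and a weak entropy solution (S) valued in
the box has strong traces in Vasseur's ess-lim L¹ form along every Lipschitz curve, from both sides,
on every [0,T′], T′ < T. A limit that is BV in x at a.e. t has them; the content is that particle
limits are at least that regular. [deps: PlanarStrongClosure] [difficulty: open-problem] -/
@[route_item "route-AtomisticToContinuum-StrongClosureWeakBV"]
def PlanarTraceRegularity : Prop :=
  let T1 : Type := UnitAddTorus (Fin 1); let pt : ℝ → T1 := fun r _ => ((r : ℝ) : UnitAddCircle); let e₀ := EuclideanSpace.single (0 : Fin 3) (1 : ℝ); let P := Literature.MathematicalPhysics.KineticTheory.hsPressure; let fx := Literature.MathematicalPhysics.KineticTheory.hsExcessFreeEnergy; let W := fun (a f φ : ℝ → T1 → ℝ) => (∫ t in Set.Ioi 0, ∫ y, (a t y * Literature.Analysis.FunctionSpaces.Torus.timeDeriv φ t y + f t y * Literature.Analysis.FunctionSpaces.Torus.partialDeriv (0 : Fin 1) (φ t) y))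 + ∫ y, a 0 y * φ 0 y; let En := fun (ρ u θ : ℝ → T1 → ℝ) (t : ℝ) (y : T1) => ρ t y * (u t y ^ 2 / 2 + 3 / 2 * θ t y); let V := fun (ρ u θ : ℝ → T1 → ℝ) (t r : ℝ) => (ρ t (pt r), u t (pt r), θ t (pt r)); let Fl := fun (σ : ℝ) => (N : ℕ) → Literature.Analysis.FluidPDE.HardSphereFlow (Literature.Analysis.FluidPDE.Torus.geometry (Fin 3)) (Literature.MathematicalPhysics.KineticTheory.hsDiameter σ N) (N + 1); let ST := fun (N : ℕ) (z : Literature.Analysis.FluidPDE.Config (N + 1) (Fin 3) (UnitAddTorus (Fin 3))) (χ : UnitAddTorus (Fin 3) → ℝ) => (Literature.MathematicalPhysics.KineticTheory.empiricalDensityField z χ, Literature.MathematicalPhysics.KineticTheory.empiricalMomentumField z χ, Literature.MathematicalPhysics.KineticTheory.empiricalEnergyField z χ); ∀ A Θ U : T1 → ℝ, Continuous A → Continuous Θ → Continuous U → (∀ y, 0 < A y ∧ 0 < Θ y) → ∃ σ₀ > (0 : ℝ), ∀ σ, 0 < σ → σ < σ₀ → ∀ η m M T : ℝ, let S := fun ρ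 u θ : ℝ → T1 → ℝ => let q := fun (t : ℝ) (y : T1) => ρ t y * u t y; let H := fun (t : ℝ) (y : T1) => -(ρ t y * (3 / 2 * Real.log (θ t y) - Real.log (ρ t y) - fx (ρ t y * σ ^ 3))); (∀ f ∈ [ρ, u, θ], Measurable (Function.uncurry f)) ∧ (∀ t ∈ Set.Ico 0 T, Filter.Tendsto (fun s : ℝ => ∫ y, dist (ρ s y, u s y, θ s y) (ρ t y, u t y, θ t y)) (nhdsWithin t (Set.Ico 0 T)) (nhds 0)) ∧ ∀ φ : ℝ → T1 → ℝ, ContDiff ℝ (⊤ : ℕ∞) (Literature.Analysis.FunctionSpaces.Torus.stLift φ) → (∃ T' < T, ∀ t, T' ≤ t → ∀ y, φ t y = 0) → W ρ q φ = 0 ∧ W q (fun t y => q t y * u t y + P σ (ρ t y) (θ t y)) φ = 0 ∧ W (En ρ u θ) (fun t y => (En ρ u θ t y + P σ (ρ t y) (θ t y)) * u t y) φ = 0 ∧ ((∀ t y, 0 ≤ φ t y) → 0 ≤ W H (fun t y => H t y * u t y) φ); let B := fun (η m M : ℝ) (ρ u θ : ℝ → T1 → ℝ) => ∀ t ∈ Set.Ico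 0 T, ∀ y, m ≤ ρ t y ∧ ρ t y ≤ M ∧ m ≤ θ t y ∧ θ t y ≤ M ∧ |u t y| ≤ M ∧ ρ t y * σ ^ 3 ≤ η; let Q := fun ρ u θ : ℝ → T1 → ℝ => ∀ X : ℝ → ℝ, (∃ K : NNReal, LipschitzWith K X) → ∃ Ul Ur : ℝ → ℝ × ℝ × ℝ, ∀ T' < T, ∀ ε > (0 : ℝ), ∃ δ > (0 : ℝ), (∀ᵐ y ∂(MeasureTheory.volume.restrict (Set.Ioo 0 δ)), (∫⁻ t in Set.Icc 0 T', ENNReal.ofReal (dist (V ρ u θ t (X t + y)) (Ur t))) ≤ ENNReal.ofReal ε) ∧ (∀ᵐ y ∂(MeasureTheory.volume.restrict (Set.Ioo 0 δ)), (∫⁻ t in Set.Icc 0 T', ENNReal.ofReal (dist (V ρ u θ t (X t - y)) (Ul t))) ≤ ENNReal.ofReal ε); ∀ Φ : Fl σ, let Lw := fun N : ℕ => Literature.MathematicalPhysics.KineticTheory.localGibbsLaw σ (fun x => A (fun _ => x 0)) (fun x => U (fun _ => x 0) • e₀) (fun x => Θ (fun _ => x 0)) N (Φ N); let LLP := fun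 (k : ℕ → ℕ) (ρ u θ : ℝ → T1 → ℝ) (t : ℝ) => ∀ χ : UnitAddTorus (Fin 3) → ℝ, Continuous χ → ∀ δ > (0 : ℝ), Filter.Tendsto (fun n : ℕ => Lw (k n) {z | δ < dist (ST (k n) ((Φ (k n)).flow t z) χ) (∫ x, χ x * ρ t (fun _ => x 0), ∫ x, (χ x * ρ t (fun _ => x 0) * u t (fun _ => x 0)) • e₀, ∫ x, χ x * En ρ u θ t (fun _ => x 0))}) Filter.atTop (nhds 0); ∀ k : ℕ → ℕ, StrictMono k → ∀ ρ' u' θ' : ℝ → T1 → ℝ, (∀ t ∈ Set.Ico 0 T, LLP k ρ' u' θ' t) → S ρ' u' θ' → B η m M ρ' u' θ' → Q ρ' u' θ'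

/-- item stmt-AtomisticToContinuum-9398 · crux · rank 5 · open · by planner
why it might fail: ChenVasseur2024: ideal gas on R, paywalled, hypotheses unverified; ideal-gas identities of relative-entropy algebra (l.D2f(r0,r0)=0, SerreVasseur2014 s6.3; holds iff covolume EOS) fail for p = rho theta Z at order eta^2 (B3 != B2^2); sup -> ess-lim traces, R -> T^1 (global small BV) unverified.
sources: ChenVasseur2024, ChenKrupaVasseur2022, SerreVasseur2014, GoldingKrupaVasseur2023, BressanGuerra2024, Vasseur2026
[crux] WEAK–BV UNIQUENESS FOR THE HARD-SPHERE LAW ON THE 1-TORUS (card crux 3; PDE). ∃ η₀ > 0 ∀ σ >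
0 ∀ box (m,M) ∃ ε₀ > 0: on any [0,T) × 𝕋¹ a weak entropy solution (S) valued in the box with packing
≤ η₀ and variation ≤ ε₀ per period at every t is UNIQUE among weak entropy solutions (S) in the same
box having ess-lim strong traces and the same t = 0 slice a.e. ChenVasseur2024 (nonisentropic ideal
gas: small-BV solutions unique among a large family of weak solutions; weighted relative entropy
with shifts + modified front tracking, CKV2022 Thm 1.3 architecture) adapted to p = ρθZ(ρσ³), e =
3θ/2 (strict hyperbolicity, genuinely nonlinear acoustic fields, strictly convex −ρs at packing <
η₀: HsEulerGNL, HsEntropyConvex), localised to the torus by finite propagation speed. [deps: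
HsEulerGNL, HsEntropyConvex] [difficulty: L] -/
@[route_item "route-AtomisticToContinuum-StrongClosureWeakBV"]
def WeakBVUniquenessHS : Prop :=
  let T1 : Type := UnitAddTorus (Fin 1); let pt : ℝ → T1 := fun r _ => ((r : ℝ) : UnitAddCircle); let P := Literature.MathematicalPhysics.KineticTheory.hsPressure; let fx := Literature.MathematicalPhysics.KineticTheory.hsExcessFreeEnergy; let W := fun (a f φ : ℝ → T1 → ℝ) => (∫ t in Set.Ioi 0, ∫ y, (a t y * Literature.Analysis.FunctionSpaces.Torus.timeDeriv φ t y + f t y * Literature.Analysis.FunctionSpaces.Torus.partialDeriv (0 : Fin 1) (φ t) y)) + ∫ y, a 0 y * φ 0 y; let En := fun (ρ u θ : ℝ → T1 → ℝ) (t : ℝ) (y : T1) => ρ t y * (u t y ^ 2 / 2 + 3 / 2 * θ t y); let V := fun (ρ u θ : ℝ → T1 → ℝ) (t r : ℝ) => (ρ t (pt r), u t (pt r), θ t (pt r)); ∃ η₀ > (0 : ℝ), ∀ σ > (0 : ℝ), ∀ m M : ℝ, 0 < m → ∃ ε₀ > (0 : ℝ), ∀ T : ℝ, let S := fun ρ u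 θ : ℝ → T1 → ℝ => let q := fun (t : ℝ) (y : T1) => ρ t y * u t y; let H := fun (t : ℝ) (y : T1) => -(ρ t y * (3 / 2 * Real.log (θ t y) - Real.log (ρ t y) - fx (ρ t y * σ ^ 3))); (∀ f ∈ [ρ, u, θ], Measurable (Function.uncurry f)) ∧ (∀ t ∈ Set.Ico 0 T, Filter.Tendsto (fun s : ℝ => ∫ y, dist (ρ s y, u s y, θ s y) (ρ t y, u t y, θ t y)) (nhdsWithin t (Set.Ico 0 T)) (nhds 0)) ∧ ∀ φ : ℝ → T1 → ℝ, ContDiff ℝ (⊤ : ℕ∞) (Literature.Analysis.FunctionSpaces.Torus.stLift φ) → (∃ T' < T, ∀ t, T' ≤ t → ∀ y, φ t y = 0) → W ρ q φ = 0 ∧ W q (fun t y => q t y * u t y + P σ (ρ t y) (θ t y)) φ = 0 ∧ W (En ρ u θ) (fun t y => (En ρ u θ t y + P σ (ρ t y) (θ t y)) * u t y) φ = 0 ∧ ((∀ t y, 0 ≤ φ t y) → 0 ≤ W H (fun t y => H t y * u t y) φ); let B := fun (η m M : ℝ) (ρ u θ : ℝ → T1 → ℝ) => ∀ t ∈ Set.Ico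 0 T, ∀ y, m ≤ ρ t y ∧ ρ t y ≤ M ∧ m ≤ θ t y ∧ θ t y ≤ M ∧ |u t y| ≤ M ∧ ρ t y * σ ^ 3 ≤ η; let Vr := fun (ε : ℝ) (ρ u θ : ℝ → T1 → ℝ) => ∀ t ∈ Set.Ico 0 T, eVariationOn (V ρ u θ t) (Set.Icc 0 1) ≤ ENNReal.ofReal ε; let Q := fun ρ u θ : ℝ → T1 → ℝ => ∀ X : ℝ → ℝ, (∃ K : NNReal, LipschitzWith K X) → ∃ Ul Ur : ℝ → ℝ × ℝ × ℝ, ∀ T' < T, ∀ ε > (0 : ℝ), ∃ δ > (0 : ℝ), (∀ᵐ y ∂(MeasureTheory.volume.restrict (Set.Ioo 0 δ)), (∫⁻ t in Set.Icc 0 T', ENNReal.ofReal (dist (V ρ u θ t (X t + y)) (Ur t))) ≤ ENNReal.ofReal ε) ∧ (∀ᵐ y ∂(MeasureTheory.volume.restrict (Set.Ioo 0 δ)), (∫⁻ t in Set.Icc 0 T', ENNReal.ofReal (dist (V ρ u θ t (X t - y)) (Ul t))) ≤ ENNReal.ofReal ε); ∀ ρ u θ : ℝ → T1 → ℝ, S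 ρ u θ → B η₀ m M ρ u θ → Vr ε₀ ρ u θ → ∀ ρ' u' θ' : ℝ → T1 → ℝ, S ρ' u' θ' → B η₀ m M ρ' u' θ' → Q ρ' u' θ' → (∀ᵐ y : T1, ρ' 0 y = ρ 0 y ∧ u' 0 y = u 0 y ∧ θ' 0 y = θ 0 y) → ∀ t ∈ Set.Ico 0 T, ∀ᵐ y : T1, ρ' t y = ρ t y ∧ u' t y = u t y ∧ θ' t y = θ t y

/-- item stmt-AtomisticToContinuum-9399 · crux · rank 9 · open · by planner
why it might fail: Dafermos2005 Thm 5.3.1 needs values in a compact set with -rho*s UNIFORMLY convex and p in C^2; as typed (inline chi-weak form, one entropy ineq., every sigma>0, box closed at packing = eta0) eta0 must lie in the virial analyticity radius (HsEosLowDensity, HsEntropyConvex); typing slip = unprovable.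
sources: Dafermos2005, Dafermos1979, DiPernaMajda1987, BrezinaFeireisl2018, Literature.MathematicalPhysics.KineticTheory.IsHardSphereEulerSolution
[support] DAFERMOS–DIPERNA WEAK–STRONG UNIQUENESS FOR hs-EULER ON 𝕋³ (known theorem). ∃ η₀ > 0 ∀ σ >
0 ∀ box (m,M) ∀ T: a classical solution (IsHardSphereEulerSolution σ T) valued in the box with
packing ≤ η₀ and a bounded weak entropy solution (same inline 3-D notion as in GeneralStrongClosure)
in the same box with the same t = 0 slice a.e. agree a.e. at every t < T. Relative entropy ∫ η(U′|U)
with η = −ρs strictly convex on the box (HsEntropyConvex), Gronwall with the Lipschitz constant of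
the classical solution on [0,t] (Dafermos2005 Thm 5.2.1 / 5.3.1-type; the single entropy inequality
suffices). [deps: HsEntropyConvex] [difficulty: L] -/
@[route_item "route-AtomisticToContinuum-StrongClosureWeakBV", crux]
def WeakStrongUniquenessHS3D : Prop :=
  ∃ η₀ > (0 : ℝ), ∀ σ > (0 : ℝ), ∀ m M : ℝ, 0 < m → ∀ T : ℝ, let W3 := fun (a : ℝ → UnitAddTorus (Fin 3) → ℝ) (F : ℝ → UnitAddTorus (Fin 3) → EuclideanSpace ℝ (Fin 3)) (φ : ℝ → UnitAddTorus (Fin 3) → ℝ) => (∫ t in Set.Ioi 0, ∫ x, (a t x * Literature.Analysis.FunctionSpaces.Torus.timeDeriv φ t x + inner ℝ (F t x) (Literature.Analysis.FunctionSpaces.Torus.gradient (φ t) x))) + ∫ x, a 0 x * φ 0 x; let S3 := fun (T : ℝ) (ρ θ : ℝ → UnitAddTorus (Fin 3) → ℝ) (u : ℝ → UnitAddTorus (Fin 3) → EuclideanSpace ℝ (Fin 3)) => let E := fun (t : ℝ) (x : UnitAddTorus (Fin 3)) => Literature.MathematicalPhysics.KineticTheory.totalEnergyDensity (ρ t x)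 (u t x) (θ t x); let p := fun (t : ℝ) (x : UnitAddTorus (Fin 3)) => Literature.MathematicalPhysics.KineticTheory.hsPressure σ (ρ t x) (θ t x); let H := fun (t : ℝ) (x : UnitAddTorus (Fin 3)) => -(ρ t x * (3 / 2 * Real.log (θ t x) - Real.log (ρ t x) - Literature.MathematicalPhysics.KineticTheory.hsExcessFreeEnergy (ρ t x * σ ^ 3))); (∀ f ∈ [ρ, θ], Measurable (Function.uncurry f)) ∧ Measurable (Function.uncurry u) ∧ (∀ t ∈ Set.Ico 0 T, Filter.Tendsto (fun s : ℝ => ∫ x, dist (ρ s x, u s x, θ s x) (ρ t x, u t x, θ t x)) (nhdsWithin t (Set.Ico 0 T)) (nhds 0)) ∧ ∀ φ : ℝ → UnitAddTorus (Fin 3) → ℝ, ContDiff ℝ (⊤ : ℕ∞) (Literature.Analysis.FunctionSpaces.Torus.stLift φ) → (∃ T' < T, ∀ t, T' ≤ t → ∀ x, φ t x = 0) → W3 ρ (fun t x => ρ t x • u t x) φ = 0 ∧ (∀ i : Fin 3, W3 (fun t x => ρ t x * u t x i) (fun t x => (ρ t x * u t x i) • u t x + p t x • EuclideanSpace.single i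 (1 : ℝ)) φ = 0) ∧ W3 E (fun t x => (E t x + p t x) • u t x) φ = 0 ∧ ((∀ t x, 0 ≤ φ t x) → 0 ≤ W3 H (fun t x => H t x • u t x) φ); let B3 := fun (η m M T : ℝ) (ρ θ : ℝ → UnitAddTorus (Fin 3) → ℝ) (u : ℝ → UnitAddTorus (Fin 3) → EuclideanSpace ℝ (Fin 3)) => ∀ t ∈ Set.Ico 0 T, ∀ x, m ≤ ρ t x ∧ ρ t x ≤ M ∧ m ≤ θ t x ∧ θ t x ≤ M ∧ ‖u t x‖ ≤ M ∧ ρ t x * σ ^ 3 ≤ η; ∀ ρ θ : ℝ → UnitAddTorus (Fin 3) → ℝ, ∀ u : ℝ → UnitAddTorus (Fin 3) → EuclideanSpace ℝ (Fin 3), Literature.MathematicalPhysics.KineticTheory.IsHardSphereEulerSolution σ T ρ u θ → B3 η₀ m M T ρ θ u → ∀ ρ' θ' : ℝ → UnitAddTorus (Fin 3) → ℝ, ∀ u' : ℝ → UnitAddTorus (Fin 3) → EuclideanSpace ℝ (Fin 3), S3 T ρ' θ' u' → B3 η₀ m M T ρ' θ' u' → (∀ᵐ x : UnitAddTorus (Fin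 3), ρ' 0 x = ρ 0 x ∧ u' 0 x = u 0 x ∧ θ' 0 x = θ 0 x) → ∀ t ∈ Set.Ico 0 T, ∀ᵐ x : UnitAddTorus (Fin 3), ρ' t x = ρ t x ∧ u' t x = u t x ∧ θ' t x = θ t x

/-- item stmt-AtomisticToContinuum-9401 · support · rank 9 · open · by planner
sources: Spohn1991, ChenVasseur2024, KangVasseurWang2021, Markfelder2021
[support] THE PLANAR POST-SHOCK THEOREM (card thesis, cut back to contact-free windows; beyond the
conjunct, hence support and not the assembly's conclusion — D-0027). ∃ η₀ > 0 ∀ continuous planar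
profiles ∃ σ₀ ∀ σ < σ₀ ∀ box ∃ ε₀ > 0 ∀ T ∀ contact-free small-BV references (S, B with packing ≤
η₀, Vr ≤ ε₀, C) ∀ flow families: LLN at t = 0 towards the planar lift ⇒ LLN towards the lift at
EVERY t < T — through shock formation, propagation, decay and shock–rarefaction interaction, up to
the first shock–shock collision (where a contact is born; see Kill criteria for why the window stops
there). For t < T* it is the conjunct on planar small-variation data. [deps: PlanarAssembly]
[difficulty: open-problem] -/
@[route_item "route-AtomisticToContinuum-StrongClosureWeakBV"]
def PlanarShockLimit : Prop :=
  let T1 : Type := UnitAddTorus (Fin 1); let pt : ℝ → T1 := fun r _ => ((r : ℝ) : UnitAddCircle); let e₀ := EuclideanSpace.single (0 : Fin 3) (1 : ℝ); let P := Literature.MathematicalPhysics.KineticTheory.hsPressure; let fx := Literature.MathematicalPhysics.KineticTheory.hsExcessFreeEnergy; let W := fun (a f φ : ℝ → T1 → ℝ) => (∫ t in Set.Ioi 0, ∫ y, (a t y * Literature.Analysis.FunctionSpaces.Torus.timeDeriv φ t y + f t y * Literature.Analysis.FunctionSpaces.Torus.partialDeriv (0 : Fin 1) (φ t) y)) + ∫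 y, a 0 y * φ 0 y; let En := fun (ρ u θ : ℝ → T1 → ℝ) (t : ℝ) (y : T1) => ρ t y * (u t y ^ 2 / 2 + 3 / 2 * θ t y); let V := fun (ρ u θ : ℝ → T1 → ℝ) (t r : ℝ) => (ρ t (pt r), u t (pt r), θ t (pt r)); let J := fun (g : ℝ → ℝ) (r : ℝ) => Function.leftLim g r = Function.rightLim g r; let Fl := fun (σ : ℝ) => (N : ℕ) → Literature.Analysis.FluidPDE.HardSphereFlow (Literature.Analysis.FluidPDE.Torus.geometry (Fin 3)) (Literature.MathematicalPhysics.KineticTheory.hsDiameter σ N) (N + 1); ∃ η₀ > (0 : ℝ), ∀ A Θ U : T1 → ℝ, Continuous A → Continuous Θ → Continuous U → (∀ y, 0 < A y ∧ 0 < Θ y) → ∃ σ₀ > (0 : ℝ), ∀ σ, 0 < σ → σ < σ₀ → ∀ m M : ℝ, 0 < m → ∃ ε₀ > (0 : ℝ), ∀ T : ℝ, let S := fun ρ u θ : ℝ → T1 → ℝ => let q := fun (t : ℝ) (y : T1) => ρ t y * u t y; let H := fun (t : ℝ) (y : T1) => -(ρ t y * (3 / 2 * Real.log (θ t y) - Real.log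 (ρ t y) - fx (ρ t y * σ ^ 3))); (∀ f ∈ [ρ, u, θ], Measurable (Function.uncurry f)) ∧ (∀ t ∈ Set.Ico 0 T, Filter.Tendsto (fun s : ℝ => ∫ y, dist (ρ s y, u s y, θ s y) (ρ t y, u t y, θ t y)) (nhdsWithin t (Set.Ico 0 T)) (nhds 0)) ∧ ∀ φ : ℝ → T1 → ℝ, ContDiff ℝ (⊤ : ℕ∞) (Literature.Analysis.FunctionSpaces.Torus.stLift φ) → (∃ T' < T, ∀ t, T' ≤ t → ∀ y, φ t y = 0) → W ρ q φ = 0 ∧ W q (fun t y => q t y * u t y + P σ (ρ t y) (θ t y)) φ = 0 ∧ W (En ρ u θ) (fun t y => (En ρ u θ t y + P σ (ρ t y) (θ t y)) * u t y) φ = 0 ∧ ((∀ t y, 0 ≤ φ t y) → 0 ≤ W H (fun t y => H t y * u t y) φ); let B := fun (η m M : ℝ) (ρ u θ : ℝ → T1 → ℝ) => ∀ t ∈ Set.Ico 0 T, ∀ y, m ≤ ρ t y ∧ ρ t y ≤ M ∧ m ≤ θ t y ∧ θ t y ≤ M ∧ |u t y| ≤ M ∧ ρ t y * σ ^ 3 ≤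 η; let Vr := fun (ε : ℝ) (ρ u θ : ℝ → T1 → ℝ) => ∀ t ∈ Set.Ico 0 T, eVariationOn (V ρ u θ t) (Set.Icc 0 1) ≤ ENNReal.ofReal ε; let C := fun ρ u : ℝ → T1 → ℝ => ∀ t ∈ Set.Ico 0 T, ∀ r : ℝ, J (fun r' => u t (pt r')) r → J (fun r' => ρ t (pt r')) r; ∀ ρ u θ : ℝ → T1 → ℝ, S ρ u θ → B η₀ m M ρ u θ → Vr ε₀ ρ u θ → C ρ u → ∀ Φ : Fl σ, let Lw := fun N : ℕ => Literature.MathematicalPhysics.KineticTheory.localGibbsLaw σ (fun x => A (fun _ => x 0)) (fun x => U (fun _ => x 0) • e₀) (fun x => Θ (fun _ => x 0)) N (Φ N); Literature.MathematicalPhysics.KineticTheory.TendstoHydroFieldsAt Lw Φ (fun s x => ρ s (fun _ => x 0)) (fun s x => u s (fun _ => x 0) • e₀) (fun s x => θ s (fun _ => x 0)) 0 → ∀ t ∈ Set.Ico 0 T, Literature.MathematicalPhysics.KineticTheory.TendstoHydroFieldsAt Lw Φ (fun s x => ρ s (fun _ => x 0)) (fun s x => u s (fun _ => x 0) • e₀)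 (fun s x => θ s (fun _ => x 0)) t

/-- item stmt-AtomisticToContinuum-9402 · support · rank 9 · open · by planner
sources: ChenKrupaVasseur2022, Dafermos2005
[support] PlanarStrongClosure → PlanarTraceRegularity → WeakBVUniquenessHS → PlanarShockLimit. Soft:
η₀ := min(η₀ of the planar closure, η₀ of weak–BV / 2), ε₀ := min(ε₀ of the closure at (η₀,m,M), ε₀
of weak–BV at the widened box (m/2,2M)); a failure of the LLN at t₀ along κ yields κ∘κ′ and an
entropic planar limit in the widened box with the reference's initial slice (closure), its strong
traces (trace crux at box (2η₀, m/2, 2M)), hence equality with the reference a.e. at every t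
(weak–BV uniqueness, references in the small box are in the widened one, Vr is monotone in ε),
contradicting the failure at t₀. [deps: PlanarStrongClosure, PlanarTraceRegularity,
WeakBVUniquenessHS, PlanarShockLimit] [difficulty: M] -/
@[route_item "route-AtomisticToContinuum-StrongClosureWeakBV"]
def PlanarAssembly : Prop :=
  PlanarStrongClosure → PlanarTraceRegularity → WeakBVUniquenessHS → PlanarShockLimit

/-- item stmt-AtomisticToContinuum-9403 · support · rank 9 · open · by planner
sources: Spohn1991, Alexander1975
[support] SYMMETRY OF THE LAW (card support (S), provable now). For every σ, profiles, N, flow Φ,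
time t: profiles invariant under a translation of 𝕋³ ⟹ the time-t law (push-forward of the local
Gibbs law by Φ_t) is invariant under translating all positions; profiles invariant under reflection
of the j-th coordinate (velocity reflected) ⟹ invariant under reflecting the j-th position and
velocity coordinates of all particles. Planar profiles: all transverse translations and both
transverse reflections. Proof: isometry invariance of canonicalDensity/hardSphereDomain, a.e.
uniqueness of hard-sphere trajectories, Liouville. [difficulty: provable-now] -/
@[route_item "route-AtomisticToContinuum-StrongClosureWeakBV"]
def PlanarLawInvariance : Prop :=
  ∀ (σ : ℝ) (a₀ θ₀ : UnitAddTorus (Fin 3) → ℝ) (u₀ : UnitAddTorus (Fin 3) → EuclideanSpace ℝ (Fin 3)) (N : ℕ) (Φ : Literature.Analysis.FluidPDE.HardSphereFlow (Literature.Analysis.FluidPDE.Torus.geometry (Fin 3)) (Literature.MathematicalPhysics.KineticTheory.hsDiameter σ N) (N + 1)) (t : ℝ), let μ := (MeasureTheory.Measure.map (Φ.flow t) (Literature.MathematicalPhysics.KineticTheory.localGibbsLaw σ a₀ u₀ θ₀ N Φ)); (∀ v : UnitAddTorus (Fin 3), (∀ x, a₀ (x + v) = a₀ x ∧ θ₀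 (x + v) = θ₀ x ∧ u₀ (x + v) = u₀ x) → MeasureTheory.Measure.map (fun z : Literature.Analysis.FluidPDE.Config (N + 1) (Fin 3) (UnitAddTorus (Fin 3)) => fun i => ((z i).1 + v, (z i).2)) μ = μ) ∧ (∀ j : Fin 3, (∀ x : UnitAddTorus (Fin 3), a₀ (fun k => if k = j then -(x k) else x k) = a₀ x ∧ θ₀ (fun k => if k = j then -(x k) else x k) = θ₀ x ∧ u₀ (fun k => if k = j then -(x k) else x k) = (WithLp.toLp 2 (fun k => if k = j then -((u₀ x) k) else (u₀ x) k))) → MeasureTheory.Measure.map (fun z : Literature.Analysis.FluidPDE.Config (N + 1) (Fin 3) (UnitAddTorus (Fin 3)) => fun i => ((fun k => if k = j then -(((z i).1) k) else ((z i).1) k), (WithLp.toLp 2 (fun k => if k = j then -(((z i).2) k) else ((z i).2) k)))) μ = μ)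

/-- item stmt-AtomisticToContinuum-9404 · support · rank 9 · open · by planner
sources: Ruelle1969, LebowitzPenrose1964, Dafermos2005
[support] STRUCTURE OF PLANAR hs-EULER AT LOW PACKING (audit flag (4)). ∃ η₀ > 0: Z =
hsCompressibility is C² on [0,η₀] and for η ≤ η₀: Φ := Z + ηZ′ + (2/3)Z² > 0 (strict hyperbolicity,
c² = θΦ) and Ψ := (2 + (2/3)Z)Φ + ηΦ′ > 0 (genuine nonlinearity of both acoustic fields: ∂²p/∂τ²|ₛ =
θτ⁻³Ψ). At η = 0: Φ = 5/3, Ψ = 40/9 = γ(γ+1), γ = 5/3 (norm_num in the planner's Check.lean); C² of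
Z near 0 is the virial analyticity (HsEosLowDensity, stmt 0768). [difficulty: M] -/
@[route_item "route-AtomisticToContinuum-StrongClosureWeakBV"]
def HsEulerGNL : Prop :=
  ∃ η₀ > (0 : ℝ), let Z := Literature.MathematicalPhysics.KineticTheory.hsCompressibility; let Φ := fun η : ℝ => Z η + η * deriv Z η + 2 / 3 * Z η ^ 2; ContDiffOn ℝ 2 Z (Set.Icc 0 η₀) ∧ ∀ η ∈ Set.Icc (0 : ℝ) η₀, 0 < Φ η ∧ 0 < (2 + 2 / 3 * Z η) * Φ η + η * deriv Φ η

/-- item stmt-AtomisticToContinuum-9405 · support · rank 9 · open · by planner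
sources: Dafermos2005, BrezinaFeireisl2018, Ruelle1969
[support] THERMODYNAMIC STABILITY (shared: identical to stmt-AtomisticToContinuum-0817 of route
DissipativeWeakStrong): strict convexity of U = (ρ,m,E) ↦ −ρ(3/2 log θ(U) − log ρ − f_ex(ρσ³)) on {ρ
> 0, ρσ³ < η₀, |m|² < 2ρE} — the single strictly convex entropy of both closers. [difficulty: M] -/
@[route_item "route-AtomisticToContinuum-StrongClosureWeakBV"]
def HsEntropyConvex : Prop :=
  ∃ η₀ : ℝ, 0 < η₀ ∧ ∀ σ : ℝ, 0 < σ → StrictConvexOn ℝ {U : ℝ × Literature.MathematicalPhysics.KineticTheory.V3 × ℝ | 0 < U.1 ∧ U.1 * σ ^ 3 < η₀ ∧ ‖U.2.1‖ ^ 2 < 2 * U.1 * U.2.2} (fun U : ℝ × Literature.MathematicalPhysics.KineticTheory.V3 × ℝ => -(U.1 * (3 / 2 * Real.log (2 / 3 * (U.2.2 / U.1 - ‖U.2.1‖ ^ 2 / (2 * U.1 ^ 2))) - Real.log U.1 - Literature.MathematicalPhysics.KineticTheory.hsExcessFreeEnergy (U.1 * σ ^ 3))))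

-- earlier Assembly2 (stmt-AtomisticToContinuum-17907, replaced 2026-08-17T00:13:16Z -> stmt-AtomisticToContinuum-18084): retired by None — GeneralStrongClosure ∧ WeakStrongUniquenessHS3D → _root_.HydrodynamicLimit
-- earlier Assembly2 (stmt-AtomisticToContinuum-18084, replaced 2026-08-17T00:55:30Z -> stmt-AtomisticToContinuum-16992): retired by None — GeneralStrongClosure → WeakStrongUniquenessHS3D → _root_.HydrodynamicLimit
/-- item stmt-AtomisticToContinuum-16992 · assembly · rank 10 · open · by planner
[assembly] THE ASSEMBLY ARROW OF THE CONJUNCT HALF — GeneralStrongClosureT →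
WeakStrongUniquenessHS3D → HydrodynamicLimit (the packing-guarded conjunct, = the former
HydroLimitInBand verbatim since p126922), restated 2026-08-17 over the REPAIRED crux
GeneralStrongClosureT (GeneralStrongClosure, stmt-9395, refuted-misstated at T = 0). RECORD ONLY:
this implication is PROVED inside the route's deciding theorem `closes (h₁ : GeneralStrongClosureT)
(h₂ : WeakStrongUniquenessHS3D) : _root_.HydrodynamicLimit` (≈170-line sorry-free soft analysis: η₀
:= min(η₁, η₂/2); 0 < T from t₀ ∈ Ico 0 T; horizon T′ ∈ (t₀,T); restriction of the classical
solution to [0,T′) by derivWithin_congr_set; box bounds on [0,T′] × 𝕋³ by compactness through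
repr/proj_repr; Filter.tendsto_of_subseq_tendsto + strictMono_subseq_of_tendsto_atTop; a.e.
identification of the entropic limit with the classical solution at t₀ by weak–strong uniqueness in
the common box; integral_congr_ae; componentwise squeeze by Prod.dist_eq / measure_mono), so the
item is closed by the one-liner `fun h₁ h₂ => closes h₁ h₂`; it is NOT a hypothesis of `closes`.
[deps: GeneralStrongClosureT, WeakStrongUniquenessHS3D] [difficulty: done — pr -/
@[route_item "route-AtomisticToContinuum-StrongClosureWeakBV"]
def Assembly2 : Prop :=
  GeneralStrongClosureT → WeakStrongUniquenessHS3D → _root_.HydrodynamicLimit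

-- records of items no longer active in this route (dropped / restated):
-- earlier Assembly (stmt-AtomisticToContinuum-17730, replaced 2026-08-16T23:35:08Z -> stmt-AtomisticToContinuum-17771): retired by None — GeneralStrongClosure → WeakStrongUniquenessHS3D → _root_.HydrodynamicLimit
-- earlier Assembly (stmt-AtomisticToContinuum-17771, dropped 2026-08-16T23:57:19Z): moot by None — GeneralStrongClosure → _root_.HydrodynamicLimit
-- earlier Assembly3 (stmt-AtomisticToContinuum-18000, dropped 2026-08-16T23:57:19Z): moot by None — WeakStrongUniquenessHS3D ∧ GeneralStrongClosure → ∃ η₀ : ℝ, 0 < η₀ ∧ ∀ (a₀ θ₀ : Literature.MathematicalPhysics.KineticTheory.T3 → ℝ) (u₀ : Literature.MathematicalPhysics.KineticTheory.T3 → Literature.MathematicalPhysics.KineticTheory.V3), Continuous a₀ → Continuous θ₀ → Continuous u₀ → (∀ x, 0 < a₀ x)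
-- earlier GeneralStrongClosure (stmt-AtomisticToContinuum-9395, replaced 2026-08-17T00:55:30Z -> stmt-AtomisticToContinuum-16991): refuted by Summit.AtomisticToContinuum.HydrodynamicLimit.Theorems.StrongClosureWeakBVGeneralStrongClosure_refuted @ 722e240af802 — ∃ η₀ > (0 : ℝ), ∀ η, 0 < η → η ≤ η₀ → ∀ a₀ θ₀ : UnitAddTorus (Fin 3) → ℝ, ∀ u₀ : UnitAddTorus (Fin 3) → EuclideanSpace ℝ (Fin 3), Continuous
-- earlier GuardedAssembly (stmt-AtomisticToContinuum-9400, replaced 2026-08-16T23:41:37Z -> stmt-AtomisticToContinuum-17857): retired by None — GeneralStrongClosure → WeakStrongUniquenessHS3D → HydroLimitInBand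
-- earlier Assembly (stmt-AtomisticToContinuum-9406, replaced 2026-08-15T14:24:27Z -> stmt-AtomisticToContinuum-9786): retired by None — DiluteSelfConsistency → HydroLimitInBand → Literature.MathematicalPhysics.KineticTheory.HydrodynamicLimit
-- earlier Assembly (stmt-AtomisticToContinuum-9786, replaced 2026-08-16T23:30:25Z -> stmt-AtomisticToContinuum-17730): retired by None — DiluteSelfConsistency → HydroLimitInBand → _root_.HydrodynamicLimit

/-! D-0027 §2.1 — DECIDING THEOREM (planner-authored via `route open/edit --closes-file`; by planner-rfix-AtomisticToContinuum-StrongClos-b8f25ab7-0 2026-08-17T00:55:30Z):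
its hypotheses are this route's items and its conclusion the sub-problem Statement (glue_lint), and it elaborates with this file. -/

@[closes "route-AtomisticToContinuum-StrongClosureWeakBV"] theorem closes (h₁ : GeneralStrongClosureT) (h₂ : WeakStrongUniquenessHS3D) :
    _root_.HydrodynamicLimit := by
  obtain ⟨η₁, hη₁, H₁⟩ := h₁
  obtain ⟨η₂, hη₂, H₂⟩ := h₂
  -- common packing threshold: `η ≤ η₁` (closure) and `2η ≤ η₂` (uniqueness box of the limit)
  obtain ⟨η, hη, hηη₁, h2η⟩ : ∃ η : ℝ, 0 < η ∧ η ≤ η₁ ∧ 2 * η ≤ η₂ :=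
    ⟨min η₁ (η₂ / 2), lt_min hη₁ (half_pos hη₂), min_le_left _ _,
      by linarith [min_le_right η₁ (η₂ / 2)]⟩
  have hηη₂ : η ≤ η₂ := by linarith
  refine ⟨η, hη, fun a₀ θ₀ u₀ ha hθ hu hap hθp => ?_⟩
  obtain ⟨σ₀, hσ₀, H₁σ⟩ := H₁ η hη hηη₁ a₀ θ₀ u₀ ha hθ hu (fun x => ⟨hap x, hθp x⟩)
  refine ⟨σ₀, hσ₀, fun σ hσ hσσ₀ T ρ θ u hsol hguard Φ hLLN0 t₀ ht₀ => ?_⟩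
  have H₁' := H₁σ σ hσ hσσ₀
  dsimp only at H₁'
  have hguard' : ∀ t ∈ Set.Ico (0 : ℝ) T, ∀ x, ρ t x * σ ^ 3 ≤ η :=
    fun t ht x => (hguard t ht x).le
  have hTpos : (0 : ℝ) < T := ht₀.1.trans_lt ht₀.2
  -- an intermediate horizon `t₀ < T' < T`
  obtain ⟨T', ht₀T', hT'T⟩ := exists_between ht₀.2
  have hT'0 : (0 : ℝ) ≤ T' := ht₀.1.trans ht₀T'.le
  have hsub : Set.Ico (0 : ℝ) T' ⊆ Set.Ico 0 T := Set.Ico_subset_Ico_right hT'T.le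
  have hIccsub : Set.Icc (0 : ℝ) T' ⊆ Set.Ico 0 T := fun s hs => ⟨hs.1, hs.2.trans_lt hT'T⟩
  have ht₀' : t₀ ∈ Set.Ico (0 : ℝ) T' := ⟨ht₀.1, ht₀T'⟩
  -- restriction of the classical solution to `[0, T')`
  have hder : ∀ {F : Type} [NormedAddCommGroup F] [NormedSpace ℝ F]
      (f : ℝ → UnitAddTorus (Fin 3) → F) {s : ℝ}, s ∈ Set.Ico (0 : ℝ) T' →
      ∀ x : UnitAddTorus (Fin 3),
      Literature.Analysis.FunctionSpaces.Torus.timeDerivWithin (Set.Ico 0 T') f s x =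
        Literature.Analysis.FunctionSpaces.Torus.timeDerivWithin (Set.Ico 0 T) f s x := by
    intro F _ _ f s hs x
    refine derivWithin_congr_set (Filter.eventuallyEq_set.2 ?_)
    filter_upwards [Iio_mem_nhds hs.2] with τ hτ
    exact ⟨fun h => ⟨h.1, h.2.trans_le hT'T.le⟩, fun h => ⟨h.1, hτ⟩⟩
  have hsolT' : Literature.MathematicalPhysics.KineticTheory.IsHardSphereEulerSolution σ T' ρ u θ :=
    { smooth_density := ContDiffOn.mono hsol.smooth_density (Set.prod_mono hsub Set.Subset.rfl)
      smooth_velocity := ContDiffOn.mono hsol.smooth_velocity (Set.prod_mono hsub Set.Subset.rfl)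
      smooth_temperature :=
        ContDiffOn.mono hsol.smooth_temperature (Set.prod_mono hsub Set.Subset.rfl)
      density_pos := fun s hs x => hsol.density_pos s (hsub hs) x
      temperature_pos := fun s hs x => hsol.temperature_pos s (hsub hs) x
      mass := fun s hs x => by
        rw [hder ρ hs x]
        exact hsol.mass s (hsub hs) x
      momentum := fun s hs x => by
        rw [hder (fun s' y => ρ s' y • u s' y) hs x]
        exact hsol.momentum s (hsub hs) x
      energy := fun s hs x => by
        rw [hder (fun s' y => Literature.MathematicalPhysics.KineticTheory.totalEnergyDensity
          (ρ s' y) (u s' y) (θ s' y)) hs x]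
        exact hsol.energy s (hsub hs) x }
  -- a compact box `[0, T'] × [0, 1]³ ⊂ ℝ × ℝ³` covering `[0, T'] × 𝕋³` through `repr`
  obtain ⟨Kc, hKc, hrepr⟩ : ∃ Kc : Set (EuclideanSpace ℝ (Fin 3)), IsCompact Kc ∧
      ∀ x : UnitAddTorus (Fin 3), Literature.Analysis.FunctionSpaces.Torus.repr x ∈ Kc :=
    ⟨(WithLp.toLp 2) '' (Set.pi Set.univ fun _ : Fin 3 => Set.Icc (0 : ℝ) 1),
      (isCompact_univ_pi fun _ => isCompact_Icc).image (PiLp.continuous_toLp 2 _),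
      fun x => ⟨fun i => ((AddCircle.equivIco (1 : ℝ) (0 : ℝ) (x i) : ℝ)),
        fun i _ => Set.Ico_subset_Icc_self
          (Literature.Analysis.FunctionSpaces.Torus.repr_apply_mem_Ico x i), rfl⟩⟩
  have hK : IsCompact (Set.Icc (0 : ℝ) T' ×ˢ Kc) := isCompact_Icc.prod hKc
  have hKsub : Set.Icc (0 : ℝ) T' ×ˢ Kc ⊆
      Set.Ico (0 : ℝ) T ×ˢ (Set.univ : Set (EuclideanSpace ℝ (Fin 3))) :=
    Set.prod_mono hIccsub (Set.subset_univ _)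
  have hKne : (Set.Icc (0 : ℝ) T' ×ˢ Kc).Nonempty :=
    ⟨(0, Literature.Analysis.FunctionSpaces.Torus.repr 0),
      Set.mk_mem_prod ⟨le_rfl, hT'0⟩ (hrepr 0)⟩
  -- uniform bounds of jointly smooth fields on `[0, T') × 𝕋³`
  have hbound : ∀ {F : Type} [NormedAddCommGroup F] [NormedSpace ℝ F]
      (f : ℝ → UnitAddTorus (Fin 3) → F),
      Literature.Analysis.FunctionSpaces.Torus.IsSmoothSpaceTimeOn (Set.Ico 0 T) f →
      ∃ C : ℝ, ∀ s ∈ Set.Ico (0 : ℝ) T', ∀ x, ‖f s x‖ ≤ C := by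
    intro F _ _ f hf
    obtain ⟨C, hC⟩ := hK.exists_bound_of_continuousOn
      ((ContDiffOn.continuousOn hf).mono hKsub)
    refine ⟨C, fun s hs x => ?_⟩
    have h := hC (s, Literature.Analysis.FunctionSpaces.Torus.repr x)
      (Set.mk_mem_prod (Set.Ico_subset_Icc_self hs) (hrepr x))
    simpa [Literature.Analysis.FunctionSpaces.Torus.stLift,
      Literature.Analysis.FunctionSpaces.Torus.proj_repr] using h
  have hlower : ∀ (f : ℝ → UnitAddTorus (Fin 3) → ℝ),
      Literature.Analysis.FunctionSpaces.Torus.IsSmoothSpaceTimeOn (Set.Ico 0 T) f →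
      (∀ s ∈ Set.Ico (0 : ℝ) T, ∀ x, 0 < f s x) →
      ∃ c : ℝ, 0 < c ∧ ∀ s ∈ Set.Ico (0 : ℝ) T', ∀ x, c ≤ f s x := by
    intro f hf hpos
    obtain ⟨p, hpK, hmin⟩ := hK.exists_isMinOn hKne ((ContDiffOn.continuousOn hf).mono hKsub)
    refine ⟨Literature.Analysis.FunctionSpaces.Torus.stLift f p,
      hpos p.1 (hIccsub (Set.mem_prod.1 hpK).1) _, fun s hs x => ?_⟩
    have h := (isMinOn_iff.1 hmin) (s, Literature.Analysis.FunctionSpaces.Torus.repr x)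
      (Set.mk_mem_prod (Set.Ico_subset_Icc_self hs) (hrepr x))
    simpa [Literature.Analysis.FunctionSpaces.Torus.stLift,
      Literature.Analysis.FunctionSpaces.Torus.proj_repr] using h
  obtain ⟨Cρ, hCρ⟩ := hbound ρ hsol.smooth_density
  obtain ⟨Cθ, hCθ⟩ := hbound θ hsol.smooth_temperature
  obtain ⟨Cu, hCu⟩ := hbound u hsol.smooth_velocity
  obtain ⟨cρ, hcρ, hcρ'⟩ := hlower ρ hsol.smooth_density hsol.density_pos
  obtain ⟨cθ, hcθ, hcθ'⟩ := hlower θ hsol.smooth_temperature hsol.temperature_pos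
  -- the law of large numbers at `t₀`, component by component, from the joint deviation bound
  intro χ hχ δ hδ
  have joint : Filter.Tendsto (fun N : ℕ =>
      Literature.MathematicalPhysics.KineticTheory.localGibbsLaw σ a₀ u₀ θ₀ N (Φ N)
        {z | δ < dist
          (Literature.MathematicalPhysics.KineticTheory.empiricalDensityField ((Φ N).flow t₀ z) χ,
            Literature.MathematicalPhysics.KineticTheory.empiricalMomentumField ((Φ N).flow t₀ z) χ,
            Literature.MathematicalPhysics.KineticTheory.empiricalEnergyField ((Φ N).flow t₀ z) χ)
          (∫ x, χ x * ρ t₀ x, ∫ x, (χ x * ρ t₀ x) • u t₀ x,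
            ∫ x, χ x * Literature.MathematicalPhysics.KineticTheory.totalEnergyDensity
              (ρ t₀ x) (u t₀ x) (θ t₀ x))})
      Filter.atTop (nhds 0) := by
    refine Filter.tendsto_of_subseq_tendsto fun ns hns => ?_
    obtain ⟨φ, -, hmono⟩ := Filter.strictMono_subseq_of_tendsto_atTop hns
    obtain ⟨κ', -, ρ', θ', u', hST, hinit, hLL⟩ :=
      H₁' T ρ θ u hsol hTpos hguard' Φ hLLN0 (ns ∘ φ) hmono
    obtain ⟨hS3, m₁, M₁, hm₁, hB3'⟩ := hST T' hT'T
    -- a common box for the classical solution and the limit on `[0, T')`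
    obtain ⟨m, hm, hmm₁, hmcρ, hmcθ⟩ : ∃ m : ℝ, 0 < m ∧ m ≤ m₁ ∧ m ≤ cρ ∧ m ≤ cθ :=
      ⟨min m₁ (min cρ cθ), lt_min hm₁ (lt_min hcρ hcθ), min_le_left _ _,
        (min_le_right _ _).trans (min_le_left _ _),
        (min_le_right _ _).trans (min_le_right _ _)⟩
    obtain ⟨M, hM₁M, hCρM, hCθM, hCuM⟩ : ∃ M : ℝ, M₁ ≤ M ∧ Cρ ≤ M ∧ Cθ ≤ M ∧ Cu ≤ M :=
      ⟨max M₁ (max Cρ (max Cθ Cu)), le_max_left _ _,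
        (le_max_left _ _).trans (le_max_right _ _),
        ((le_max_left _ _).trans (le_max_right _ _)).trans (le_max_right _ _),
        ((le_max_right _ _).trans (le_max_right _ _)).trans (le_max_right _ _)⟩
    have hBcl : ∀ s ∈ Set.Ico (0 : ℝ) T', ∀ x, m ≤ ρ s x ∧ ρ s x ≤ M ∧ m ≤ θ s x ∧ θ s x ≤ M ∧
        ‖u s x‖ ≤ M ∧ ρ s x * σ ^ 3 ≤ η₂ := fun s hs x =>
      ⟨hmcρ.trans (hcρ' s hs x), (Real.le_norm_self _).trans ((hCρ s hs x).trans hCρM),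
        hmcθ.trans (hcθ' s hs x), (Real.le_norm_self _).trans ((hCθ s hs x).trans hCθM),
        (hCu s hs x).trans hCuM, (hguard s (hsub hs) x).le.trans hηη₂⟩
    have hB3w : ∀ s ∈ Set.Ico (0 : ℝ) T', ∀ x, m ≤ ρ' s x ∧ ρ' s x ≤ M ∧ m ≤ θ' s x ∧
        θ' s x ≤ M ∧ ‖u' s x‖ ≤ M ∧ ρ' s x * σ ^ 3 ≤ η₂ := fun s hs x => by
      obtain ⟨h1, h2, h3, h4, h5, h6⟩ := hB3' s hs x
      exact ⟨hmm₁.trans h1, h2.trans hM₁M, hmm₁.trans h3, h4.trans hM₁M, h5.trans hM₁M,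
        h6.trans h2η⟩
    have H₂' := H₂ σ hσ m M hm T'
    dsimp only at H₂'
    have hae := H₂' ρ θ u hsolT' hBcl ρ' θ' u' hS3 hB3w hinit t₀ ht₀'
    have e₁ : ∫ x, χ x * ρ' t₀ x = ∫ x, χ x * ρ t₀ x :=
      MeasureTheory.integral_congr_ae (by
        filter_upwards [hae] with x hx
        rw [hx.1])
    have e₂ : ∫ x, (χ x * ρ' t₀ x) • u' t₀ x = ∫ x, (χ x * ρ t₀ x) • u t₀ x :=
      MeasureTheory.integral_congr_ae (by
        filter_upwards [hae] with x hx
        rw [hx.1, hx.2.1])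
    have e₃ : ∫ x, χ x * Literature.MathematicalPhysics.KineticTheory.totalEnergyDensity
          (ρ' t₀ x) (u' t₀ x) (θ' t₀ x) =
        ∫ x, χ x * Literature.MathematicalPhysics.KineticTheory.totalEnergyDensity
          (ρ t₀ x) (u t₀ x) (θ t₀ x) :=
      MeasureTheory.integral_congr_ae (by
        filter_upwards [hae] with x hx
        rw [hx.1, hx.2.1, hx.2.2])
    have hlim := hLL t₀ ht₀ χ hχ δ hδ
    rw [e₁, e₂, e₃] at hlim
    exact ⟨φ ∘ κ', hlim⟩
  refine ⟨?_, ?_, ?_⟩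
  · refine tendsto_of_tendsto_of_tendsto_of_le_of_le tendsto_const_nhds joint
      (fun N => zero_le) fun N => ?_
    refine MeasureTheory.measure_mono fun z hz => ?_
    simp only [Set.mem_setOf_eq] at hz ⊢
    refine lt_of_lt_of_le hz ?_
    rw [← Real.dist_eq, Prod.dist_eq]
    exact le_max_left _ _
  · refine tendsto_of_tendsto_of_tendsto_of_le_of_le tendsto_const_nhds joint
      (fun N => zero_le) fun N => ?_
    refine MeasureTheory.measure_mono fun z hz => ?_
    simp only [Set.mem_setOf_eq] at hz ⊢
    refine lt_of_lt_of_le hz ?_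
    rw [← dist_eq_norm, Prod.dist_eq, Prod.dist_eq]
    exact le_max_of_le_right (le_max_left _ _)
  · refine tendsto_of_tendsto_of_tendsto_of_le_of_le tendsto_const_nhds joint
      (fun N => zero_le) fun N => ?_
    refine MeasureTheory.measure_mono fun z hz => ?_
    simp only [Set.mem_setOf_eq] at hz ⊢
    refine lt_of_lt_of_le hz ?_
    rw [← Real.dist_eq, Prod.dist_eq, Prod.dist_eq]
    exact le_max_of_le_right (le_max_right _ _)

end Summit.AtomisticToContinuum.HydrodynamicLimit.Theses.StrongClosureWeakBV
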